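import Literature.Geometry.Kaehler.ComplexTorusCentralizerRosati
import Literature.Geometry.Kaehler.ComplexTorusKaehlerCone
import Literature.Geometry.Kaehler.ComplexTorusDivisorClasses
import Literature.LinearAlgebra.Alternating.DerivationExtension
import Mathlib.LinearAlgebra.BilinearForm.Orthogonal
import HarnessLib

/-!
# Looijenga–Lunts 1997 §3: `End⁰(X)^±`, the Lie ideal `𝔲(X)` of the Rosati anti-invariants, and the last clause of
# Proposition (3.6) — `End⁰(X) = (the Lie ideal generated by End⁰(X)^+) × 𝔲(X)`

Layer `Literature/Geometry/Kaehler`, namespace `Literature.Geometry.Kaehler.ComplexTorus`; lane `lit-hodgefound` (Track 2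
foundations library, Layer A), skeleton seat `lit-hodgefound-skel-1` (generation 25), row **A1-53** of
`run/shared/lean/pub/lit-hodgefound/SKELETON.md` — the `End⁰(X)`-side of Looijenga–Lunts' Proposition (3.6) on the abelian
variety example (sequel of rows A1-50 `ComplexTorusNeronSeveriLieBracket.lean`, (3.5), and A1-52
`ComplexTorusPolarizationsSingleOrbit.lean`, the sentence before (3.6)).  Definitions WITH BODIES and theorems only: no named
fact, no `sorry` (net debt `0`).  A junction of tree records, consumed BY NAME, nothing restated:

* `ComplexTorusRosati` (A2, P-pre-07): `End⁰(X) = End_ℚ(X) = endAlgRat Φ ⊆ M_ι(ℚ)` (rational representation), the Rosati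
  involution `rosati G A = G⁻¹ ᵗA G` with `rosati_mul`, `rosati_rosati`, `rosati_one`, `trace_rosati`, `rosati_eq_iff`,
  `rosati_mem_endAlgRat`, **`rosatiTraceForm_pos`** (Lange Thm. 2.4.9: `Tr(A† A) > 0`), `isUnit_det_of_map_ratCast`,
  `transpose_eq_neg_of_map_ratCast`, `IsRiemannForm.exists_ratMatrix_latticeGram`;
* A2-31 `ComplexTorusNeronSeveriEndomorphisms`: `NS_ℚ(X) = neronSeveriQ Φ`, `ratGram`, `map_ratGram`, `ratGram_add/_smul`,
  `ratGram_eq_of_map_eq`, `symmEndRat`, `nsToEnd` (Lange's `φ : L ↦ φ_{L₀}⁻¹ φ_L`), `nsToEnd_mem_symmEndRat`,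
  **`exists_nsToEnd_eq`** (Prop. 2.4.12: `φ` is onto `End^s_ℚ(X)`), `exists_nsmul_mem_neronSeveriGroup`;
* `ComplexTorusCentralizerRosati` (addendum): **`rosati_mul_right_eq_conj`** (`†_{Gα} β = α⁻¹ (†_G β) α`, Milne §1);
* `ComplexTorusKaehlerCone` (Huybrechts Cor. 3.1.8 / Ex. 3.2.12 for tori): `isRiemannForm_iff_neg_mem_kaehlerCone`,
  **`exists_forall_lt_smul_add_mem_kaehlerCone`** ("`tα + β` is a Kähler class for `t ≫ 0`");
* (§9 only) `LinearAlgebra/Alternating/DerivationExtension` (p06): the derivation extension **`adAlt T`** of an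
  endomorphism `T` of `H₁(X; ℝ) = E` to `k`-covectors (`adAlt_apply_two`, the Leibniz rule `adAlt_wedge`,
  `adAlt_of_degree_zero`, `adAlt_smul_right`, `compContinuousAlternatingMap_adAlt`); `ComplexTorusAnalyticCharpoly`:
  `analyticRepReal Φ Φ B = Φ ∘ B ∘ Φ⁻¹` (a real matrix read on `E`); `ComplexTorusHodgeClasses`: `ofRealForm`,
  `neronSeveriGroup Φ = NS(X)`; A4-15 `ComplexTorusDivisorClasses`: `wedgeFamily`, **`divisorClasses Φ p = Dᵖ(X)`** (the
  `ℚ`-span of the wedge monomials of `NS(X)`-classes: the degree-`2p` part of the subalgebra generated by `NS(X)`);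
* Mathlib `LinearMap.BilinForm.orthogonal`, `orthogonal_orthogonal`, `isCompl_orthogonal_iff_disjoint`,
  `LieSubmodule.lieSpan`, `LieRing.ofAssociativeRing` (file-local instance, §8 only).

## Sources, VERBATIM

E. Looijenga, V. A. Lunts, *A Lie algebra attached to a projective variety*, Invent. Math. **129** (1997) 361–412, §3
(held text `paper:arxiv-alg-geom_9604014`, p0014 and p0016):

> (p0014 L58–L62) "Let us write `End⁰(X)^±` for the `±1`-eigen space of `†` in `End⁰(X)`. Since `†` is an
> anti-involution, `End⁰(X)^-` is a Lie subalgebra of `End⁰(X)` and `End⁰(X)^+` is a module of this Lie algebra."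
>
> (L63–L68) "The group of units `(End(X) ⊗ ℝ)^×` acts on `NS(X) ⊗ ℝ` and it is well-known that the polarisations are
> contained in a single orbit. So the Rosati involutions are all conjugate under `(End(X) ⊗ ℝ)^×`. **Let `𝔲(X)` denote the
> set of elements in `End⁰(X)` that are anti-invariant with respect to all Rosati involutions. This is clearly a Lie ideal
> in `End⁰(X)`.**"
>
> (L70–L76) "**(3.6) Proposition.** The Néron–Severi Lie algebra of the abelian variety `X` is of Jordan type. Its degree
> `2` summand is canonically isomorphic to `NS(X) ⊗ ℚ`. Its degree `0` summand can be identified with the Lie ideal of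
> `End⁰(X)` that is generated by `End⁰(X)^+` and this isomorphism makes `h` correspond to a scalar operator in `End⁰(X)`.
> **Moreover, `End⁰(X) = 𝔤_NS(X; ℚ)_0 × 𝔲(X)`.**"
>
> (proof, L87–L94) "If `σ ∈ End⁰(X)^-` and `τ ∈ End⁰(X)^+`, then `Tr(στ) = Tr((στ)†) = Tr(-τσ) = -Tr(στ)` (here `Tr`
> denotes the `ℚ`-trace). This shows that `End⁰(X)^-` is the the orthoplement of `End⁰(X)^+` in `End⁰(X)` with respect
> to the trace form. So `𝔲(X)` is the orthogonal complement of the span of the elements fixed by some Rosati involution.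
> This orthoplement is an ideal as well and hence equal to `𝔤_NS(X)_0`."
>
> (p0016 L85–L88) "let us observe that `𝔲(X)` kills the Néron–Severi group, hence kills the subalgebra of `Hdg(X)`
> generated by this group. So as soon as `𝔲(X)` acts nontrivially on `Hdg(X)`, `X` will have Hodge classes that are not
> in this subalgebra."

Inputs, also printed: H. Lange, *Abelian Varieties over the Complex Numbers* (2023), §2.4.1 Lemma 2.4.1 (`'` is an
anti-involution of `End_ℚ(X)`), **Theorem 2.4.9** ("`(f, g) ↦ Tr_r(f'g)` is a positive definite symmetric bilinear
form"), §2.4.2 **Prop. 2.4.12** ("`φ : NS_ℚ(X) → End^s_ℚ(X)`, `L ↦ φ_{L₀}⁻¹ φ_L` is an isomorphism"); J. S. Milne,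
*Lefschetz classes on abelian varieties*, Duke Math. J. **96** (1999), §1 p. 642 ("the involution defined by `D′` (if also
ample) is `β ↦ α⁻¹ β† α`"); D. Huybrechts, *Complex Geometry* (2005), Exercise 3.2.12 ("`tα + β` is a Kähler class for
`t ≫ 0`").

## Reading (dictionary) — what `End⁰(X)`, `†`, `Tr`, `𝔲(X)`, "generated by", "×" are here

`X = E/Φ(ℤ^ι)` is a complex torus (period isomorphism `Φ : ℝ^ι ≃L[ℝ] E`) ADMITTING A POLARISATION (an abelian variety),
read in lattice coordinates: `H₁(X; ℚ) = Λ ⊗ ℚ = ℚ^ι`, `End⁰(X) = End_ℚ(X) = endAlgRat Φ` (the rational matrices commuting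
with the complex structure), used as the TYPE `↥(endAlgRat Φ)` (a `ℚ`-algebra); a polarisation is a Riemann form `η`
(`IsRiemannForm Φ η`: type `(1,1)`, integral on the lattice, `η(iu, u) > 0`) with RATIONAL Gram matrix `G`
(`G.map Rat.cast = latticeGram Φ η`; it exists, `IsRiemannForm.exists_ratMatrix_latticeGram`); its Rosati involution is
`A ↦ A† = rosati G A = G⁻¹ ᵗA G` (the `ℚ`-linear map `rosatiQ`), `End⁰(X)^± = rosatiSymm Φ G`, `rosatiSkew Φ G`;
"`Tr` denotes the `ℚ`-trace" = `Matrix.trace` on `M_ι(ℚ)`, the trace form `endTraceForm Φ A B = Tr(AB)`;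
`𝔲(X) = rosatiAntiInvariants Φ` (anti-invariant for the Rosati involution of EVERY polarisation);
`S = rosatiSymmSpan Φ` ("the span of the elements fixed by some Rosati involution");
`I = rosatiSymmIdeal Φ G₀ := End⁰(X)^+ + [End⁰(X)^+, End⁰(X)^+]`, proved to be "the Lie ideal of `End⁰(X)` that is
generated by `End⁰(X)^+`" (smallest `ad`-stable subspace containing `End⁰(X)^+`, `rosatiSymmIdeal_le`; Mathlib's
`LieSubmodule.lieSpan`, `rosatiSymmLieIdeal_eq_lieSpan`) and independent of `L₀`; the Lie bracket is the ring commutator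
`⁅A, B⁆ = AB - BA` (`Ring.lie_def`); "`×`" = complementary subspaces, both Lie ideals, with `⁅I, 𝔲(X)⁆ = 0`.

## Contents

* §1 (L58–L62) `rosatiSymm`, `rosatiSkew`, `rosatiQ` (+ `_mul`, `_rosatiQ`, `_one`, `_lie`); `End⁰ = E^+ ⊕ E^-`
  (`isCompl_rosatiSymm_rosatiSkew`); **`lie_mem_rosatiSkew`** ("`End⁰(X)^-` is a Lie subalgebra"),
  **`lie_mem_rosatiSymm_of_skew_of_symm`** ("`End⁰(X)^+` is a module of this Lie algebra"), `lie_mem_rosatiSkew_of_symm_of_symm`,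
  `mul_add_mul_mem_rosatiSymm` (Jordan product).
* §2 (L87–L92) `endTraceForm` (symmetric, invariant `Tr(⁅A,B⁆C) = Tr(A⁅B,C⁆)`),
  **`endTraceForm_eq_zero_of_mem_rosatiSkew_of_mem_rosatiSymm`** (the printed computation `Tr(στ) = 0`),
  `endTraceForm_rosatiQ_self_pos` / `endTraceForm_nondegenerate` (Lange 2.4.9),
  **`mem_rosatiSkew_iff_forall_endTraceForm_eq_zero`** / **`rosatiSkew_eq_orthogonal_rosatiSymm`** ("`End⁰(X)^-` is the
  orthoplement of `End⁰(X)^+`"), `rosatiSymm_eq_orthogonal_rosatiSkew`.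
* §3 (L63–L66, Milne) the transporter `γ = φ_{L₀}⁻¹ φ_{L₁} = G₀⁻¹ G₁ ∈ End⁰(X)^{+,L₀}` (`transporter`),
  **`rosati_eq_conj_inv_mul`** (`†₁ = Ad(γ⁻¹) ∘ †₀`), **`mem_rosatiSymm_iff_transporter_mul_mem`** /
  `mem_rosatiSkew_iff_transporter_mul_mem` (`E^{±,L₁} = {A | γA ∈ E^{±,L₀}}`).
* §4 **`exists_isRiemannForm_smul_add`** (`N η₀ + m θ` is a polarisation, `θ ∈ NS_ℚ(X)`),
  **`span_setOf_isRiemannForm_eq_neronSeveriQ`** (the polarisations span `NS_ℚ(X)`), `polTransporters`,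
  **`span_polTransporters_eq_rosatiSymm`** (the transporters span `End⁰(X)^+`).
* §5 (L66–L68, p0016 L85) **`rosatiAntiInvariants`** = `𝔲(X)`; **`mem_rosatiAntiInvariants_iff_forall_commute`**
  (`𝔲(X) = E^{-,L₀} ∩ C(E^{+,L₀})` for ANY single polarisation `L₀`); **`lie_mem_rosatiAntiInvariants`** ("clearly a Lie
  ideal"); **`mem_rosatiAntiInvariants_iff_forall_neronSeveriQ`** (`A ∈ 𝔲(X) ⟺ ᵗA G_θ + G_θ A = 0` for all `θ ∈ NS_ℚ(X)`:
  "`𝔲(X)` kills the Néron–Severi group") and the form-level `apply_mulVec_add_apply_mulVec_eq_zero`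
  (`θ(ρ_r(A)u, v) + θ(u, ρ_r(A)v) = 0`).
* §6 (L73–L76, L92–L94) `rosatiSymmSpan` (`S`), **`rosatiAntiInvariants_eq_orthogonal_rosatiSymmSpan`** (`𝔲(X) = S^⊥`),
  `rosatiSymmIdeal` (`I`) with `lie_mem_rosatiSymmIdeal` (a Lie ideal) and `rosatiSymmIdeal_le` (generated by `E^+`),
  `rosatiSymmIdeal_eq_span_mul` (`I = span(E^+·E^+)`), **`rosatiSymmIdeal_eq_rosatiSymmSpan`** (`I = S`, so `I` is
  independent of `L₀`, `rosatiSymmIdeal_eq_rosatiSymmIdeal`; "this orthoplement is an ideal as well" —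
  `lie_mem_rosatiSymmSpan`), `rosatiAntiInvariants_eq_orthogonal_rosatiSymmIdeal`,
  `disjoint_rosatiSymmIdeal_rosatiAntiInvariants`, **`isCompl_rosatiSymmIdeal_rosatiAntiInvariants`**
  (**`End⁰(X) = I ⊕ 𝔲(X)`**), `existsUnique_add_eq`, `finrank_rosatiSymmIdeal_add_finrank_rosatiAntiInvariants`,
  **`mul_comm_of_mem_rosatiSymmIdeal_of_mem_rosatiAntiInvariants`** / `lie_eq_zero_…` (`⁅I, 𝔲(X)⁆ = 0`), `lie_add_add_eq`
  (the bracket splits: a PRODUCT of Lie algebras).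
* §7 consequences for the referee: commutative `End⁰(X)` ⇒ `𝔲(X) = End⁰(X)^-`, `I = End⁰(X)^+` (CM field: the purely
  imaginary elements; totally real: `0` — (3.7)'s exceptional case "purely imaginary scalars in `K`"); `End⁰(X)^+ = End⁰(X)`
  (trivial Rosati involution, e.g. `End⁰(X) = ℚ`) ⇒ `𝔲(X) = 0`, `I = End⁰(X)`; `1 ∈ I`, `1 ∉ 𝔲(X)`.
* §8 the same in Mathlib's `LieIdeal` language for the commutator Lie algebra of `End⁰(X)`
  (`attribute [local instance] LieRing.ofAssociativeRing`): `rosatiAntiInvariantsLieIdeal`, `rosatiSymmLieIdeal`,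
  **`rosatiSymmLieIdeal_eq_lieSpan`** (`I = LieSubmodule.lieSpan ℚ End⁰(X) End⁰(X)^+`, verbatim "generated by"),
  **`isCompl_rosatiSymmLieIdeal_rosatiAntiInvariantsLieIdeal`**, **`lie_rosatiSymmLieIdeal_rosatiAntiInvariantsLieIdeal_eq_bot`**.
* §9 (p0016 L85–L86, "hence kills the subalgebra of `Hdg(X)` generated by this group"): for `A ∈ 𝔲(X)` the derivation
  `ad ρ_r(A)` of `⋀• H¹(X; ℝ) ⊗ ℂ` (`adAlt (analyticRepReal Φ Φ A_ℝ)`) kills every `θ ∈ NS_ℚ(X)`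
  (**`adAlt_analyticRepReal_eq_zero_of_mem_rosatiAntiInvariants`**, real and complex-valued), every wedge monomial of
  killed `2`-forms (`adAlt_wedgeFamily_eq_zero`, Leibniz), hence all of `Dᵖ(X)` for every `p`
  (**`adAlt_analyticRepReal_eq_zero_of_mem_divisorClasses`**); L87–L88 "so as soon as `𝔲(X)` acts nontrivially on
  `Hdg(X)`, `X` will have Hodge classes that are not in this subalgebra":
  `not_mem_divisorClasses_of_adAlt_analyticRepReal_ne_zero`, **`divisorClasses_lt_hodgeClasses_of_adAlt_analyticRepReal_ne_zero`**
  (`Dᵖ(X) ⊊ H^{2p}_Hodge(X)` as soon as some `A ∈ 𝔲(X)` moves a Hodge class of degree `2p`).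

## Proofs (where they are not the printed ones)

Looijenga–Lunts reach "`S` is an ideal, `𝔲(X) = S^⊥ = 𝔤_NS(X)_0^⊥`" through the Néron–Severi Lie algebra and the density
of the Rosati involutions in one conjugacy class.  Here, WITHOUT `𝔤_NS`: (a) by Milne's formula `†_L = Ad(γ_L⁻¹) ∘ †₀`
(`γ_L = φ_{L₀}⁻¹ φ_L`, the tree's `rosati_mul_right_eq_conj`) an element is anti-invariant under all Rosati involutions iff
it is `†₀`-anti-invariant and commutes with every `γ_L`; (b) the `γ_L` span `End⁰(X)^{+,L₀}` (Lange Prop. 2.4.12 plus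
"the polarisations span `NS_ℚ(X)`", itself from the openness of the Kähler/ample cone, the tree's
`exists_forall_lt_smul_add_mem_kaehlerCone`), whence `𝔲(X) = E^{-,L₀} ∩ C(E^{+,L₀})`, a Lie ideal by Jacobi; (c)
`S = span(E^{+,L₀} · E^{+,L₀}) = E^+ + [E^+, E^+] = I` (`βγ_L ∈ E^{+,L}` for `β ∈ E^{+,L₀}`; `A = γ⁻¹(γA)` for
`A ∈ E^{+,L}`), so `I` is independent of `L₀` and `𝔲(X) = I^⊥`; (d) `I ∩ 𝔲(X) = 0` by the positivity `Tr(A†A) > 0`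
(`A ∈ I ∩ I^⊥` with `A† = -A` has `Tr(A†A) = -Tr(AA) = 0`), and `I ⊕ I^⊥ = End⁰(X)` by dimension
(`isCompl_orthogonal_iff_disjoint`); `[I, 𝔲(X)] = 0` because `𝔲(X)` commutes with `E^+`.

## Scope (faithfulness)

1. Of Proposition (3.6) ONLY the last clause is formalised, and in the following form: with `𝔤_NS(X; ℚ)_0` replaced by
   (3.6)'s own description of it — "the Lie ideal of `End⁰(X)` that is generated by `End⁰(X)^+`", the `I` above —
   `End⁰(X) = I ⊕ 𝔲(X)` with `I`, `𝔲(X)` commuting Lie ideals.  The Néron–Severi Lie algebra `𝔤_NS(X)` itself, "of Jordan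
   type", "degree `2` summand ≅ `NS(X) ⊗ ℚ`", the isomorphism `𝔤_NS(X; ℚ)_0 ≅ I` and "`h` ↦ a scalar operator" are NOT
   claimed (they need Looijenga–Lunts (1.6)); nor is the density clause of the printed proof.
2. "all Rosati involutions" = the Rosati involutions of all polarisations (Riemann forms: integral, positive, type `(1,1)`);
   the hypotheses `hη₀ : IsRiemannForm Φ η₀`, `hG₀` supply ONE polarisation where a statement needs `X` to be an abelian
   variety (without any, the defining condition of `𝔲(X)` is vacuous: `rosatiAntiInvariants_eq_top_of_not_isAbelianVariety`).
3. "kills the Néron–Severi group" is proved as the vanishing of the derivation action `G ↦ ᵗA G + G A` of `End(H₁(X; ℚ))` on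
   the Gram matrices of all of `NS_ℚ(X)` (and on the `2`-forms themselves); "hence kills the subalgebra of `Hdg(X)`
   generated by this group" is proved (§9) degree by degree, as the vanishing of the derivation `ad ρ_r(A)` of
   `⋀• H¹(X; ℝ) ⊗ ℂ = Alt^•_ℝ(E; ℂ)` on the tree's `divisorClasses Φ p = Dᵖ(X)` (the degree-`2p` part of that subalgebra,
   `D⁰ = ℚ·1`) for every `p` — the action of `End(H₁)` on cohomology by derivations being the tree's `adAlt` (the
   differential of the pull-back action, `DerivationExtension`) — with "as soon as `𝔲(X)` acts nontrivially on `Hdg(X)`,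
   `X` will have Hodge classes that are not in this subalgebra" as its contrapositive on `hodgeClasses Φ p`.  The
   `𝔤_NS(X)`-module structure of `Hdg(X)` and "This often happens when `𝔲(X) ≠ 0` [Moonen–Zarhin]" are NOT formalised
   here.  Nothing in this file is a case of the Hodge conjecture.

## References

* [LooijengaLunts1997] E. Looijenga, V. A. Lunts, *A Lie algebra attached to a projective variety*, Invent. Math. 129
  (1997) 361–412, §3: before (3.6), (3.6) Proposition and its proof (arXiv p. 14), end of §3 (arXiv p. 16).
* [Lange2023AbelianVarietiesComplex] H. Lange, *Abelian Varieties over the Complex Numbers*, Springer (2023), §2.4.1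
  Lemma 2.4.1, Theorem 2.4.9; §2.4.2 Prop. 2.4.12; §1.5.1.
* [Milne1999LefschetzClasses] J. S. Milne, *Lefschetz classes on abelian varieties*, Duke Math. J. 96 (1999) 639–675,
  §1 (p. 642) and Remark 1.4 (p. 644).
* [Huybrechts2005] D. Huybrechts, *Complex Geometry. An Introduction*, Springer (2005), §3.1 Cor. 3.1.8, §3.2
  Exercise 3.2.12.
-/

noncomputable section

open Matrix Module

namespace Literature.Geometry.Kaehler

namespace ComplexTorus

variable {ι : Type*} [Fintype ι] [DecidableEq ι] {E : Type*} [NormedAddCommGroup E] [NormedSpace ℂ E]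
  (Φ : (ι → ℝ) ≃L[ℝ] E)

/-! ## §1 `End⁰(X)^±` for one polarisation -/

section Eigenspaces

/-- **`End⁰(X)^+`**, the `+1`-eigenspace of the Rosati involution `† = rosati G` (`A† = G⁻¹ ᵗA G`) inside the
`ℚ`-algebra `End⁰(X) = End_ℚ(X) = endAlgRat Φ` (rational representation on `H₁(X; ℚ) = ℚ^ι`), for the rational Gram
matrix `G` of a polarisation; as a `ℚ`-subspace of the TYPE `↥(endAlgRat Φ)` (its image in `M_ι(ℚ)` is the tree's
`symmEndRat Φ G`, `mem_rosatiSymm_iff_coe_mem_symmEndRat`). [cite: LooijengaLunts1997, §3 (before (3.6)), p. 14 L58] -/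
def rosatiSymm (G : Matrix ι ι ℚ) : Submodule ℚ (endAlgRat Φ) where
  carrier := {A | rosati G (A : Matrix ι ι ℚ) = A}
  add_mem' {A B} hA hB := by
    simp only [Set.mem_setOf_eq, Subalgebra.coe_add] at hA hB ⊢
    rw [rosati_add, hA, hB]
  zero_mem' := by simp [rosati]
  smul_mem' c {A} hA := by
    simp only [Set.mem_setOf_eq, Subalgebra.coe_smul] at hA ⊢
    rw [rosati_smul, hA]

/-- **`End⁰(X)^-`**, the `-1`-eigenspace of the Rosati involution `† = rosati G` inside `End⁰(X) = endAlgRat Φ`.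
[cite: LooijengaLunts1997, §3 (before (3.6)), p. 14 L58] -/
def rosatiSkew (G : Matrix ι ι ℚ) : Submodule ℚ (endAlgRat Φ) where
  carrier := {A | rosati G (A : Matrix ι ι ℚ) = -A}
  add_mem' {A B} hA hB := by
    simp only [Set.mem_setOf_eq, Subalgebra.coe_add] at hA hB ⊢
    rw [rosati_add, hA, hB, neg_add]
  zero_mem' := by simp [rosati]
  smul_mem' c {A} hA := by
    simp only [Set.mem_setOf_eq, Subalgebra.coe_smul] at hA ⊢
    rw [rosati_smul, hA, smul_neg]

variable {Φ}

omit [Fintype ι] in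
/-- Membership in `End⁰(X)^+`: `A† = A`. [cite: LooijengaLunts1997, §3, p. 14 L58] -/
theorem mem_rosatiSymm_iff [Fintype ι] {G : Matrix ι ι ℚ} {A : endAlgRat Φ} :
    A ∈ rosatiSymm Φ G ↔ rosati G (A : Matrix ι ι ℚ) = A :=
  Iff.rfl

omit [Fintype ι] in
/-- Membership in `End⁰(X)^-`: `A† = -A`. [cite: LooijengaLunts1997, §3, p. 14 L58] -/
theorem mem_rosatiSkew_iff [Fintype ι] {G : Matrix ι ι ℚ} {A : endAlgRat Φ} :
    A ∈ rosatiSkew Φ G ↔ rosati G (A : Matrix ι ι ℚ) = -A :=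
  Iff.rfl

/-- `End⁰(X)^+` is the tree's `symmEndRat Φ G = End^s_ℚ(X)` (Lange Prop. 2.4.12) read on the type `End⁰(X)`.
[cite: LooijengaLunts1997, §3, p. 14 L58] [cite: Lange2023AbelianVarietiesComplex, §2.4.2 (symmetric elements)] -/
theorem mem_rosatiSymm_iff_coe_mem_symmEndRat {G : Matrix ι ι ℚ} {A : endAlgRat Φ} :
    A ∈ rosatiSymm Φ G ↔ (A : Matrix ι ι ℚ) ∈ symmEndRat Φ G := by
  rw [mem_rosatiSymm_iff, mem_symmEndRat_iff]
  exact ⟨fun h ↦ ⟨A.2, h⟩, fun h ↦ h.2⟩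

/-- The image of `End⁰(X)^+` in `M_ι(ℚ)` is `symmEndRat Φ G`. [cite: Lange2023AbelianVarietiesComplex, §2.4.2] -/
theorem map_val_rosatiSymm (G : Matrix ι ι ℚ) :
    (rosatiSymm Φ G).map (endAlgRat Φ).val.toLinearMap = symmEndRat Φ G := by
  ext A
  simp only [Submodule.mem_map, AlgHom.toLinearMap_apply, Subalgebra.coe_val]
  constructor
  · rintro ⟨B, hB, rfl⟩
    exact mem_rosatiSymm_iff_coe_mem_symmEndRat.1 hB
  · intro hA
    exact ⟨⟨A, hA.1⟩, mem_rosatiSymm_iff_coe_mem_symmEndRat.2 hA, rfl⟩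

section OnePolarisation

variable {η : E [⋀^Fin 2]→L[ℝ] ℝ} (hη : IsRiemannForm Φ η) {G : Matrix ι ι ℚ}
  (hG : G.map (Rat.cast : ℚ → ℝ) = latticeGram Φ η)
include hη hG

/-- The rational Gram matrix of a polarisation is invertible. [cite: Lange2023AbelianVarietiesComplex, §1.4.2 Prop. 1.4.7] -/
theorem isUnit_det_of_isRiemannForm : IsUnit G.det :=
  isUnit_det_of_map_ratCast hG hη.isUnit_det_latticeGram

omit hη in
/-- The rational Gram matrix of a polarisation is alternating. [cite: Lange2023AbelianVarietiesComplex, §1.5.1] -/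
theorem transpose_eq_neg_of_isRiemannForm : Gᵀ = -G :=
  transpose_eq_neg_of_map_ratCast Φ hG

/-- **The Rosati involution as a `ℚ`-linear map of `End⁰(X)`** (Lange Lemma 2.4.1: it preserves `End_ℚ(X)`).
[cite: LooijengaLunts1997, §3, p. 14 L32–L36] [cite: Lange2023AbelianVarietiesComplex, §2.4.1 Lemma 2.4.1] -/
def rosatiQ : endAlgRat Φ →ₗ[ℚ] endAlgRat Φ where
  toFun A := ⟨rosati G (A : Matrix ι ι ℚ), rosati_mem_endAlgRat Φ hη.1 hη.2.2 hG A.2⟩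
  map_add' A B := Subtype.ext (by simp [rosati_add])
  map_smul' c A := Subtype.ext (by simp [rosati_smul])

/-- `(A†) = rosati G A` as matrices. [cite: Lange2023AbelianVarietiesComplex, §2.4.1 Lemma 2.4.1] -/
@[simp] theorem coe_rosatiQ (A : endAlgRat Φ) : (rosatiQ hη hG A : Matrix ι ι ℚ) = rosati G (A : Matrix ι ι ℚ) :=
  rfl

/-- `†` is an involution of `End⁰(X)`: `A†† = A`. [cite: LooijengaLunts1997, §3, p. 14 L33 ("(anti-)involution")]
[cite: Lange2023AbelianVarietiesComplex, §2.4.1 Lemma 2.4.1] -/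
theorem rosatiQ_rosatiQ (A : endAlgRat Φ) : rosatiQ hη hG (rosatiQ hη hG A) = A :=
  Subtype.ext (rosati_rosati (isUnit_det_of_isRiemannForm hη hG) (transpose_eq_neg_of_isRiemannForm hG) _)

/-- `†` is an ANTI-involution: `(AB)† = B† A†`. [cite: LooijengaLunts1997, §3, p. 14 L33]
[cite: Lange2023AbelianVarietiesComplex, §2.4.1 Lemma 2.4.1] -/
theorem rosatiQ_mul (A B : endAlgRat Φ) : rosatiQ hη hG (A * B) = rosatiQ hη hG B * rosatiQ hη hG A :=
  Subtype.ext (by simp [rosati_mul (isUnit_det_of_isRiemannForm hη hG)])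

/-- `1† = 1`. [cite: Lange2023AbelianVarietiesComplex, §2.4.1 Lemma 2.4.1] -/
theorem rosatiQ_one : rosatiQ hη hG 1 = 1 :=
  Subtype.ext (by simp [rosati_one (isUnit_det_of_isRiemannForm hη hG)])

/-- `†` reverses commutators: `⁅A, B⁆† = ⁅B†, A†⁆`. [cite: LooijengaLunts1997, §3, p. 14 L60] -/
theorem rosatiQ_lie (A B : endAlgRat Φ) :
    rosatiQ hη hG ⁅A, B⁆ = ⁅rosatiQ hη hG B, rosatiQ hη hG A⁆ := by
  simp only [Ring.lie_def, map_sub, rosatiQ_mul]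

/-- `1 ∈ End⁰(X)^+`. [cite: Lange2023AbelianVarietiesComplex, §2.4.1 Lemma 2.4.1] -/
theorem one_mem_rosatiSymm : (1 : endAlgRat Φ) ∈ rosatiSymm Φ G := by
  rw [mem_rosatiSymm_iff, Subalgebra.coe_one, rosati_one (isUnit_det_of_isRiemannForm hη hG)]

/-- `A + A† ∈ End⁰(X)^+`. [cite: LooijengaLunts1997, §3, p. 14 L58] -/
theorem add_rosatiQ_mem_rosatiSymm (A : endAlgRat Φ) : A + rosatiQ hη hG A ∈ rosatiSymm Φ G := by
  rw [mem_rosatiSymm_iff, Subalgebra.coe_add, coe_rosatiQ, rosati_add,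
    rosati_rosati (isUnit_det_of_isRiemannForm hη hG) (transpose_eq_neg_of_isRiemannForm hG), add_comm]

/-- `A - A† ∈ End⁰(X)^-`. [cite: LooijengaLunts1997, §3, p. 14 L58] -/
theorem sub_rosatiQ_mem_rosatiSkew (A : endAlgRat Φ) : A - rosatiQ hη hG A ∈ rosatiSkew Φ G := by
  rw [mem_rosatiSkew_iff, Subalgebra.coe_sub, coe_rosatiQ, rosati_sub,
    rosati_rosati (isUnit_det_of_isRiemannForm hη hG) (transpose_eq_neg_of_isRiemannForm hG), neg_sub]

/-- **`End⁰(X) = End⁰(X)^+ ⊕ End⁰(X)^-`**, spanning half: `A = ½(A + A†) + ½(A - A†)`.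
[cite: LooijengaLunts1997, §3, p. 14 L58 ("the `±1`-eigen space of `†`")] -/
theorem rosatiSymm_sup_rosatiSkew_eq_top : rosatiSymm Φ G ⊔ rosatiSkew Φ G = ⊤ := by
  refine eq_top_iff.2 fun A _ ↦ ?_
  have h : A = (2 : ℚ)⁻¹ • (A + rosatiQ hη hG A) + (2 : ℚ)⁻¹ • (A - rosatiQ hη hG A) := by
    rw [← smul_add, add_add_sub_cancel, ← two_smul ℚ A, smul_smul, inv_mul_cancel₀ two_ne_zero, one_smul]
  rw [h]
  exact Submodule.add_mem_sup (Submodule.smul_mem _ _ (add_rosatiQ_mem_rosatiSymm hη hG A))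
    (Submodule.smul_mem _ _ (sub_rosatiQ_mem_rosatiSkew hη hG A))

omit hη hG in
/-- **`End⁰(X)^+ ∩ End⁰(X)^- = 0`** (`A = A† = -A† ⇒ A = 0` in characteristic `0`).
[cite: LooijengaLunts1997, §3, p. 14 L58] -/
theorem rosatiSymm_inf_rosatiSkew_eq_bot : rosatiSymm Φ G ⊓ rosatiSkew Φ G = ⊥ := by
  refine eq_bot_iff.2 fun A hA ↦ ?_
  obtain ⟨h₁, h₂⟩ := Submodule.mem_inf.1 hA
  rw [mem_rosatiSymm_iff] at h₁
  rw [mem_rosatiSkew_iff, h₁] at h₂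
  have h : (A : Matrix ι ι ℚ) = 0 := by
    have h2 : (2 : ℚ) • (A : Matrix ι ι ℚ) = 0 := by rw [two_smul]; nth_rw 2 [h₂]; exact add_neg_cancel _
    exact (smul_eq_zero.1 h2).resolve_left two_ne_zero
  exact (Submodule.mem_bot ℚ).2 (Subtype.ext h)

/-- `End⁰(X)^+` and `End⁰(X)^-` are complementary subspaces of `End⁰(X)`. [cite: LooijengaLunts1997, §3, p. 14 L58] -/
theorem isCompl_rosatiSymm_rosatiSkew : IsCompl (rosatiSymm Φ G) (rosatiSkew Φ G) :=
  IsCompl.of_eq rosatiSymm_inf_rosatiSkew_eq_bot (rosatiSymm_sup_rosatiSkew_eq_top hη hG)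

/-- **"Since `†` is an anti-involution, `End⁰(X)^-` is a Lie subalgebra of `End⁰(X)`"**: `A† = -A`, `B† = -B`
`⇒ ⁅A, B⁆† = ⁅B†, A†⁆ = ⁅B, A⁆ = -⁅A, B⁆`. [cite: LooijengaLunts1997, §3, p. 14 L60–L62] -/
theorem lie_mem_rosatiSkew {A B : endAlgRat Φ} (hA : A ∈ rosatiSkew Φ G) (hB : B ∈ rosatiSkew Φ G) :
    ⁅A, B⁆ ∈ rosatiSkew Φ G := by
  rw [mem_rosatiSkew_iff] at hA hB ⊢
  have h := congrArg Subtype.val (rosatiQ_lie hη hG A B)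
  simp only [coe_rosatiQ] at h
  rw [h]
  have hA' : rosatiQ hη hG A = -A := Subtype.ext (by simpa using hA)
  have hB' : rosatiQ hη hG B = -B := Subtype.ext (by simpa using hB)
  rw [hA', hB']
  simp only [Ring.lie_def, Subalgebra.coe_sub, Subalgebra.coe_mul, Subalgebra.coe_neg]
  noncomm_ring

/-- **"and `End⁰(X)^+` is a module of this Lie algebra"**: `⁅End⁰(X)^-, End⁰(X)^+⁆ ⊆ End⁰(X)^+`.
[cite: LooijengaLunts1997, §3, p. 14 L60–L62] -/
theorem lie_mem_rosatiSymm_of_skew_of_symm {A B : endAlgRat Φ} (hA : A ∈ rosatiSkew Φ G) (hB : B ∈ rosatiSymm Φ G) :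
    ⁅A, B⁆ ∈ rosatiSymm Φ G := by
  rw [mem_rosatiSkew_iff] at hA
  rw [mem_rosatiSymm_iff] at hB ⊢
  have h := congrArg Subtype.val (rosatiQ_lie hη hG A B)
  simp only [coe_rosatiQ] at h
  rw [h]
  have hA' : rosatiQ hη hG A = -A := Subtype.ext (by simpa using hA)
  have hB' : rosatiQ hη hG B = B := Subtype.ext (by simpa using hB)
  rw [hA', hB']
  simp only [Ring.lie_def, Subalgebra.coe_sub, Subalgebra.coe_mul, Subalgebra.coe_neg]
  noncomm_ring

/-- `⁅End⁰(X)^+, End⁰(X)^+⁆ ⊆ End⁰(X)^-`. [cite: LooijengaLunts1997, §3, p. 14 L60–L62] -/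
theorem lie_mem_rosatiSkew_of_symm_of_symm {A B : endAlgRat Φ} (hA : A ∈ rosatiSymm Φ G) (hB : B ∈ rosatiSymm Φ G) :
    ⁅A, B⁆ ∈ rosatiSkew Φ G := by
  rw [mem_rosatiSymm_iff] at hA hB
  rw [mem_rosatiSkew_iff]
  have h := congrArg Subtype.val (rosatiQ_lie hη hG A B)
  simp only [coe_rosatiQ] at h
  rw [h]
  have hA' : rosatiQ hη hG A = A := Subtype.ext (by simpa using hA)
  have hB' : rosatiQ hη hG B = B := Subtype.ext (by simpa using hB)
  rw [hA', hB']
  simp only [Ring.lie_def, Subalgebra.coe_sub, Subalgebra.coe_mul]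
  noncomm_ring

/-- The Jordan product stays in `End⁰(X)^+`: `AB + BA ∈ End⁰(X)^+` for `A, B ∈ End⁰(X)^+`.
[cite: LooijengaLunts1997, §3, p. 14 L58–L62] -/
theorem mul_add_mul_mem_rosatiSymm {A B : endAlgRat Φ} (hA : A ∈ rosatiSymm Φ G) (hB : B ∈ rosatiSymm Φ G) :
    A * B + B * A ∈ rosatiSymm Φ G := by
  rw [mem_rosatiSymm_iff] at hA hB ⊢
  rw [Subalgebra.coe_add, Subalgebra.coe_mul, Subalgebra.coe_mul, rosati_add,
    rosati_mul (isUnit_det_of_isRiemannForm hη hG), rosati_mul (isUnit_det_of_isRiemannForm hη hG), hA, hB, add_comm]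

end OnePolarisation

end Eigenspaces

/-! ## §2 The `ℚ`-trace form; `End⁰(X)^-` is the orthoplement of `End⁰(X)^+` -/

section TraceForm

/-- **The `ℚ`-trace form `(σ, τ) ↦ Tr(στ)` on `End⁰(X)`** — the trace of `στ` acting on `H₁(X; ℚ) = ℚ^ι` ("here `Tr`
denotes the `ℚ`-trace"). [cite: LooijengaLunts1997, §3, proof of (3.6), p. 14 L87–L90] -/
def endTraceForm : LinearMap.BilinForm ℚ (endAlgRat Φ) :=
  LinearMap.mk₂ ℚ (fun A B ↦ Matrix.trace ((A : Matrix ι ι ℚ) * (B : Matrix ι ι ℚ)))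
    (fun A A' B ↦ by simp only [Subalgebra.coe_add, Matrix.add_mul, Matrix.trace_add])
    (fun c A B ↦ by simp only [Subalgebra.coe_smul, Matrix.smul_mul, Matrix.trace_smul, smul_eq_mul])
    (fun A B B' ↦ by simp only [Subalgebra.coe_add, Matrix.mul_add, Matrix.trace_add])
    (fun c A B ↦ by simp only [Subalgebra.coe_smul, Matrix.mul_smul, Matrix.trace_smul, smul_eq_mul])

variable {Φ}

/-- `endTraceForm Φ A B = Tr(AB)`. [cite: LooijengaLunts1997, §3, proof of (3.6), p. 14 L87–L90] -/
@[simp] theorem endTraceForm_apply (A B : endAlgRat Φ) :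
    endTraceForm Φ A B = Matrix.trace ((A : Matrix ι ι ℚ) * (B : Matrix ι ι ℚ)) :=
  rfl

/-- The trace form is symmetric: `Tr(AB) = Tr(BA)`. [cite: LooijengaLunts1997, §3, proof of (3.6), p. 14 L87–L90] -/
theorem endTraceForm_comm (A B : endAlgRat Φ) : endTraceForm Φ A B = endTraceForm Φ B A := by
  rw [endTraceForm_apply, endTraceForm_apply, Matrix.trace_mul_comm]

/-- The trace form is reflexive (symmetric). [cite: LooijengaLunts1997, §3, proof of (3.6), p. 14 L87–L90] -/
theorem isRefl_endTraceForm : (endTraceForm Φ).IsRefl := fun A B h ↦ by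
  rwa [endTraceForm_comm]

/-- The trace form is invariant: `Tr(⁅A, B⁆ C) = Tr(A ⁅B, C⁆)`.
[cite: LooijengaLunts1997, §3, proof of (3.6), p. 14 L93 ("an ideal as well")] -/
theorem endTraceForm_lie (A B C : endAlgRat Φ) : endTraceForm Φ ⁅A, B⁆ C = endTraceForm Φ A ⁅B, C⁆ := by
  simp only [endTraceForm_apply, Ring.lie_def, Subalgebra.coe_sub, Subalgebra.coe_mul, Matrix.sub_mul,
    Matrix.mul_sub, Matrix.trace_sub, Matrix.mul_assoc]
  congr 1
  rw [Matrix.trace_mul_comm, Matrix.mul_assoc]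

section OnePolarisation

variable {η : E [⋀^Fin 2]→L[ℝ] ℝ} (hη : IsRiemannForm Φ η) {G : Matrix ι ι ℚ}
  (hG : G.map (Rat.cast : ℚ → ℝ) = latticeGram Φ η)
include hη hG

/-- `Tr(A†) = Tr(A)`. [cite: Lange2023AbelianVarietiesComplex, §2.4.1 (rational trace), p. 114] -/
theorem trace_coe_rosatiQ (A : endAlgRat Φ) :
    Matrix.trace (rosatiQ hη hG A : Matrix ι ι ℚ) = Matrix.trace (A : Matrix ι ι ℚ) := by
  rw [coe_rosatiQ, trace_rosati (isUnit_det_of_isRiemannForm hη hG)]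

/-- `Tr(A† B†) = Tr(BA)` (`= Tr((BA)†)`). [cite: LooijengaLunts1997, §3, proof of (3.6), p. 14 L87–L89] -/
theorem endTraceForm_rosatiQ_rosatiQ (A B : endAlgRat Φ) :
    endTraceForm Φ (rosatiQ hη hG A) (rosatiQ hη hG B) = endTraceForm Φ B A := by
  rw [endTraceForm_apply, endTraceForm_apply, ← Subalgebra.coe_mul, ← rosatiQ_mul, trace_coe_rosatiQ, Subalgebra.coe_mul]

/-- **"If `σ ∈ End⁰(X)^-` and `τ ∈ End⁰(X)^+`, then `Tr(στ) = Tr((στ)†) = Tr(-τσ) = -Tr(στ)`"**, so `Tr(στ) = 0`.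
[cite: LooijengaLunts1997, §3, proof of (3.6), p. 14 L87–L90] -/
theorem endTraceForm_eq_zero_of_mem_rosatiSkew_of_mem_rosatiSymm {A B : endAlgRat Φ} (hA : A ∈ rosatiSkew Φ G)
    (hB : B ∈ rosatiSymm Φ G) : endTraceForm Φ A B = 0 := by
  have hA' : rosatiQ hη hG A = -A := Subtype.ext (by simpa using mem_rosatiSkew_iff.1 hA)
  have hB' : rosatiQ hη hG B = B := Subtype.ext (by simpa using mem_rosatiSymm_iff.1 hB)
  -- `Tr(AB) = Tr((AB)†) = Tr(B† A†) = Tr(B (-A)) = -Tr(AB)`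
  have h : endTraceForm Φ A B = -endTraceForm Φ A B := by
    conv_lhs => rw [endTraceForm_comm, ← endTraceForm_rosatiQ_rosatiQ hη hG A B, hA', hB', map_neg,
      LinearMap.neg_apply]
  linarith

/-- The same with the arguments swapped: `Tr(τσ) = 0` for `τ ∈ End⁰(X)^+`, `σ ∈ End⁰(X)^-`.
[cite: LooijengaLunts1997, §3, proof of (3.6), p. 14 L87–L90] -/
theorem endTraceForm_eq_zero_of_mem_rosatiSymm_of_mem_rosatiSkew {A B : endAlgRat Φ} (hA : A ∈ rosatiSymm Φ G)
    (hB : B ∈ rosatiSkew Φ G) : endTraceForm Φ A B = 0 := by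
  rw [endTraceForm_comm, endTraceForm_eq_zero_of_mem_rosatiSkew_of_mem_rosatiSymm hη hG hB hA]

/-- **Positivity of the Rosati involution** (Lange Thm. 2.4.9, the tree's `rosatiTraceForm_pos`): `Tr(A† A) > 0` for
`A ≠ 0` in `End⁰(X)`. [cite: Lange2023AbelianVarietiesComplex, §2.4.1 Theorem 2.4.9] -/
theorem endTraceForm_rosatiQ_self_pos {A : endAlgRat Φ} (hA : A ≠ 0) : 0 < endTraceForm Φ (rosatiQ hη hG A) A := by
  have hA0 : (A : Matrix ι ι ℚ) ≠ 0 := fun h ↦ hA (Subtype.ext h)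
  simpa using rosatiTraceForm_pos hη hG A.2 hA0

/-- `Tr(A A†) > 0` for `A ≠ 0`. [cite: Lange2023AbelianVarietiesComplex, §2.4.1 Theorem 2.4.9] -/
theorem endTraceForm_self_rosatiQ_pos {A : endAlgRat Φ} (hA : A ≠ 0) : 0 < endTraceForm Φ A (rosatiQ hη hG A) := by
  rw [endTraceForm_comm]
  exact endTraceForm_rosatiQ_self_pos hη hG hA

/-- **The `ℚ`-trace form is non-degenerate on `End⁰(X)`** (test against `A†`: `Tr(A A†) > 0`).
[cite: LooijengaLunts1997, §3, proof of (3.6), p. 14 L90–L92] [cite: Lange2023AbelianVarietiesComplex, §2.4.1 Theorem 2.4.9] -/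
theorem endTraceForm_nondegenerate : (endTraceForm Φ).Nondegenerate := by
  refine (LinearMap.IsRefl.nondegenerate_iff_separatingLeft (isRefl_endTraceForm (Φ := Φ))).2 ?_
  intro A hA
  by_contra hA0
  have h0 : endTraceForm Φ A (rosatiQ hη hG A) = 0 := hA _
  exact (endTraceForm_self_rosatiQ_pos hη hG hA0).ne' h0

/-- A symmetric element with `Tr(A A) = 0` vanishes. [cite: Lange2023AbelianVarietiesComplex, §2.4.1 Theorem 2.4.9] -/
theorem eq_zero_of_mem_rosatiSymm_of_endTraceForm_self_eq_zero {A : endAlgRat Φ} (hA : A ∈ rosatiSymm Φ G)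
    (h : endTraceForm Φ A A = 0) : A = 0 := by
  by_contra hA0
  have hA' : rosatiQ hη hG A = A := Subtype.ext (by simpa using mem_rosatiSymm_iff.1 hA)
  have hp := endTraceForm_rosatiQ_self_pos hη hG hA0
  rw [hA', h] at hp
  exact lt_irrefl _ hp

/-- A skew element with `Tr(A A) = 0` vanishes. [cite: Lange2023AbelianVarietiesComplex, §2.4.1 Theorem 2.4.9] -/
theorem eq_zero_of_mem_rosatiSkew_of_endTraceForm_self_eq_zero {A : endAlgRat Φ} (hA : A ∈ rosatiSkew Φ G)
    (h : endTraceForm Φ A A = 0) : A = 0 := by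
  by_contra hA0
  have hA' : rosatiQ hη hG A = -A := Subtype.ext (by simpa using mem_rosatiSkew_iff.1 hA)
  have hp := endTraceForm_rosatiQ_self_pos hη hG hA0
  rw [hA', map_neg, LinearMap.neg_apply, h, neg_zero] at hp
  exact lt_irrefl _ hp

/-- **"This shows that `End⁰(X)^-` is the orthoplement of `End⁰(X)^+` in `End⁰(X)` with respect to the trace form"**:
`σ ∈ End⁰(X)^-` iff `Tr(τσ) = 0` for every `τ ∈ End⁰(X)^+`.
[cite: LooijengaLunts1997, §3, proof of (3.6), p. 14 L90–L92] -/
theorem mem_rosatiSkew_iff_forall_endTraceForm_eq_zero {A : endAlgRat Φ} :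
    A ∈ rosatiSkew Φ G ↔ ∀ B ∈ rosatiSymm Φ G, endTraceForm Φ B A = 0 := by
  refine ⟨fun hA B hB ↦ endTraceForm_eq_zero_of_mem_rosatiSymm_of_mem_rosatiSkew hη hG hB hA, fun h ↦ ?_⟩
  -- `P = A + A† ∈ End⁰(X)^+`, `M = A - A† ∈ End⁰(X)^-`, `2A = P + M`; `Tr(PA) = 0 = Tr(PM)` force `Tr(PP) = 0`, `P = 0`.
  set P := A + rosatiQ hη hG A with hPdef
  have hP : P ∈ rosatiSymm Φ G := add_rosatiQ_mem_rosatiSymm hη hG A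
  have hM := sub_rosatiQ_mem_rosatiSkew hη hG A
  have h1 : endTraceForm Φ P A = 0 := h _ hP
  have h2 : endTraceForm Φ P (A - rosatiQ hη hG A) = 0 :=
    endTraceForm_eq_zero_of_mem_rosatiSymm_of_mem_rosatiSkew hη hG hP hM
  have h3 : endTraceForm Φ P P = 0 := by
    have e : (2 : ℚ) • A - (A - rosatiQ hη hG A) = P := by rw [hPdef, two_smul]; abel
    calc endTraceForm Φ P P = endTraceForm Φ P ((2 : ℚ) • A - (A - rosatiQ hη hG A)) := by rw [e]
      _ = 0 := by rw [map_sub, map_smul, h1, h2, smul_zero, sub_zero]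
  have hP0 : P = 0 := eq_zero_of_mem_rosatiSymm_of_endTraceForm_self_eq_zero hη hG hP h3
  rw [mem_rosatiSkew_iff]
  have e : rosatiQ hη hG A = -A := eq_neg_of_add_eq_zero_right hP0
  simpa using congrArg Subtype.val e

/-- **`End⁰(X)^- = (End⁰(X)^+)^⊥`** for the `ℚ`-trace form (Mathlib's `LinearMap.BilinForm.orthogonal`).
[cite: LooijengaLunts1997, §3, proof of (3.6), p. 14 L90–L92] -/
theorem rosatiSkew_eq_orthogonal_rosatiSymm : rosatiSkew Φ G = (endTraceForm Φ).orthogonal (rosatiSymm Φ G) := by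
  refine Submodule.ext fun A ↦ ?_
  rw [mem_rosatiSkew_iff_forall_endTraceForm_eq_zero hη hG, LinearMap.BilinForm.mem_orthogonal_iff]

/-- Dually `End⁰(X)^+ = (End⁰(X)^-)^⊥`. [cite: LooijengaLunts1997, §3, proof of (3.6), p. 14 L90–L92] -/
theorem rosatiSymm_eq_orthogonal_rosatiSkew :
    rosatiSymm Φ G = (endTraceForm Φ).orthogonal (rosatiSkew Φ G) := by
  rw [rosatiSkew_eq_orthogonal_rosatiSymm hη hG]
  exact (LinearMap.BilinForm.orthogonal_orthogonal (V := endAlgRat Φ) (endTraceForm_nondegenerate hη hG)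
    isRefl_endTraceForm _).symm

end OnePolarisation

end TraceForm

/-! ## §3 All polarisations: the transporter `φ_{L₀}⁻¹ φ_{L₁}`, and `†₁ = Ad(γ⁻¹) ∘ †₀` -/

section Transporter

variable {Φ} {η₀ : E [⋀^Fin 2]→L[ℝ] ℝ} (hη₀ : IsRiemannForm Φ η₀) {G₀ : Matrix ι ι ℚ}
  (hG₀ : G₀.map (Rat.cast : ℚ → ℝ) = latticeGram Φ η₀)
  {η₁ : E [⋀^Fin 2]→L[ℝ] ℝ} (hη₁ : IsRiemannForm Φ η₁) {G₁ : Matrix ι ι ℚ}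
  (hG₁ : G₁.map (Rat.cast : ℚ → ℝ) = latticeGram Φ η₁)

include hη₁ hG₁ in
/-- The rational Gram matrix of a polarisation is the tree's `ratGram`. [cite: Lange2023AbelianVarietiesComplex, §1.5.1] -/
theorem eq_ratGram_of_isRiemannForm : G₁ = ratGram Φ η₁ :=
  (ratGram_eq_of_map_eq hη₁.1 hG₁).symm

include hη₁ hG₁ in
/-- `G₀⁻¹ G₁ = φ(L₁) = ρ_r(φ_{L₀}⁻¹ φ_{L₁})` is the tree's `nsToEnd Φ G₀ L₁` (Lange Prop. 2.4.12).
[cite: Lange2023AbelianVarietiesComplex, §2.4.2 Prop. 2.4.12] -/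
theorem inv_mul_eq_nsToEnd :
    G₀⁻¹ * G₁ = nsToEnd Φ G₀ ⟨η₁, mem_neronSeveriQ_of_isRiemannForm Φ hη₁⟩ := by
  rw [nsToEnd_apply, ← eq_ratGram_of_isRiemannForm hη₁ hG₁]

include hη₀ hG₀ hη₁ hG₁ in
/-- `G₀⁻¹ G₁ ∈ End^s_ℚ(X)` for the Rosati involution of `L₀`. [cite: Lange2023AbelianVarietiesComplex, §2.4.2 Prop. 2.4.12] -/
theorem inv_mul_mem_symmEndRat : G₀⁻¹ * G₁ ∈ symmEndRat Φ G₀ := by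
  rw [inv_mul_eq_nsToEnd hη₁ hG₁]
  exact nsToEnd_mem_symmEndRat hη₀.1 hG₀ (isUnit_det_of_isRiemannForm hη₀ hG₀) _

/-- **The transporter `γ = φ_{L₀}⁻¹ φ_{L₁} ∈ End⁰(X)`** between two polarisations (rational representation `G₀⁻¹ G₁`,
`G₁ = G₀ γ`; Milne's `α` with "`e_{D′} = e_D ∘ (α × 1)`"). [cite: LooijengaLunts1997, §3, p. 14 L63–L66]
[cite: Lange2023AbelianVarietiesComplex, §2.4.2 Prop. 2.4.12] [cite: Milne1999LefschetzClasses, §1 (p. 642)] -/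
def transporter : endAlgRat Φ :=
  ⟨G₀⁻¹ * G₁, (inv_mul_mem_symmEndRat hη₀ hG₀ hη₁ hG₁).1⟩

/-- `γ = G₀⁻¹ G₁` as a matrix. [cite: Lange2023AbelianVarietiesComplex, §2.4.2 Prop. 2.4.12] -/
@[simp] theorem coe_transporter : (transporter hη₀ hG₀ hη₁ hG₁ : Matrix ι ι ℚ) = G₀⁻¹ * G₁ :=
  rfl

/-- `γ ∈ End⁰(X)^+` for `†₀` ("`α† = α`"). [cite: Milne1999LefschetzClasses, §1 (p. 642)]
[cite: Lange2023AbelianVarietiesComplex, §2.4.2 Prop. 2.4.12] -/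
theorem transporter_mem_rosatiSymm : transporter hη₀ hG₀ hη₁ hG₁ ∈ rosatiSymm Φ G₀ :=
  mem_rosatiSymm_iff_coe_mem_symmEndRat.2 (inv_mul_mem_symmEndRat hη₀ hG₀ hη₁ hG₁)

include hη₀ hG₀ in
/-- `G₀ (G₀⁻¹ G₁) = G₁`. [cite: Lange2023AbelianVarietiesComplex, §2.4.2 Prop. 2.4.12] -/
theorem mul_inv_mul_eq : G₀ * (G₀⁻¹ * G₁) = G₁ :=
  Matrix.mul_nonsing_inv_cancel_left _ _ (isUnit_det_of_isRiemannForm hη₀ hG₀)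

include hη₀ hG₀ hη₁ hG₁ in
/-- The transporter is invertible. [cite: Lange2023AbelianVarietiesComplex, §2.4.2 Prop. 2.4.12] -/
theorem isUnit_det_inv_mul : IsUnit (G₀⁻¹ * G₁).det := by
  rw [Matrix.det_mul]
  exact (Matrix.isUnit_nonsing_inv_det _ (isUnit_det_of_isRiemannForm hη₀ hG₀)).mul
    (isUnit_det_of_isRiemannForm hη₁ hG₁)

include hη₀ hG₀ in
/-- The inverse transporter is the transporter back: `(G₀⁻¹ G₁)⁻¹ = G₁⁻¹ G₀`.
[cite: Lange2023AbelianVarietiesComplex, §2.4.2 Prop. 2.4.12] -/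
theorem inv_mul_inv : (G₀⁻¹ * G₁)⁻¹ = G₁⁻¹ * G₀ := by
  rw [Matrix.mul_inv_rev, Matrix.nonsing_inv_nonsing_inv _ (isUnit_det_of_isRiemannForm hη₀ hG₀)]

/-- The transporter of `L₀` to itself is `1`. [cite: Lange2023AbelianVarietiesComplex, §2.4.2 Prop. 2.4.12] -/
theorem transporter_self : transporter hη₀ hG₀ hη₀ hG₀ = 1 :=
  Subtype.ext (by simp [Matrix.nonsing_inv_mul _ (isUnit_det_of_isRiemannForm hη₀ hG₀)])

include hη₀ hG₀ in
/-- **"So the Rosati involutions are all conjugate"** at the rational level (Milne: "the involution defined by `D′` … is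
`β ↦ α⁻¹ β† α`"): `†₁ = Ad(γ⁻¹) ∘ †₀` with `γ = G₀⁻¹ G₁` — the tree's `rosati_mul_right_eq_conj` at `G₁ = G₀ γ`.
[cite: LooijengaLunts1997, §3, p. 14 L64–L66] [cite: Milne1999LefschetzClasses, §1 (p. 642)] -/
theorem rosati_eq_conj_inv_mul (A : Matrix ι ι ℚ) : rosati G₁ A = (G₀⁻¹ * G₁)⁻¹ * rosati G₀ A * (G₀⁻¹ * G₁) := by
  conv_lhs => rw [← mul_inv_mul_eq hη₀ hG₀ (G₁ := G₁)]
  exact rosati_mul_right_eq_conj G₀ (G₀⁻¹ * G₁) A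

omit [DecidableEq ι] in
/-- `γ⁻¹ B γ = C ⟺ B γ = γ C` for an invertible `γ`. [folklore] -/
private theorem inv_mul_mul_eq_iff [DecidableEq ι] {γ : Matrix ι ι ℚ} (hγ : IsUnit γ.det) (B C : Matrix ι ι ℚ) :
    γ⁻¹ * B * γ = C ↔ B * γ = γ * C := by
  constructor
  · intro h
    calc B * γ = γ * (γ⁻¹ * (B * γ)) := (Matrix.mul_nonsing_inv_cancel_left _ _ hγ).symm
      _ = γ * C := by rw [← Matrix.mul_assoc γ⁻¹ B γ, h]
  · intro h
    rw [Matrix.mul_assoc, h, Matrix.nonsing_inv_mul_cancel_left _ _ hγ]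

include hη₀ hG₀ hη₁ hG₁ in
/-- **`End⁰(X)^{+,L₁} = {A | γA ∈ End⁰(X)^{+,L₀}}`**: `A†₁ = A ⟺ A†₀ γ = γ A ⟺ (γA)†₀ = γA` (`γ†₀ = γ`).
[cite: LooijengaLunts1997, §3, p. 14 L64–L66] [cite: Milne1999LefschetzClasses, §1 (p. 642)] -/
theorem mem_rosatiSymm_iff_transporter_mul_mem {A : endAlgRat Φ} :
    A ∈ rosatiSymm Φ G₁ ↔ transporter hη₀ hG₀ hη₁ hG₁ * A ∈ rosatiSymm Φ G₀ := by
  have hγs : rosati G₀ (G₀⁻¹ * G₁) = G₀⁻¹ * G₁ := (inv_mul_mem_symmEndRat hη₀ hG₀ hη₁ hG₁).2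
  rw [mem_rosatiSymm_iff, mem_rosatiSymm_iff, Subalgebra.coe_mul, coe_transporter,
    rosati_mul (isUnit_det_of_isRiemannForm hη₀ hG₀), hγs, rosati_eq_conj_inv_mul hη₀ hG₀]
  exact inv_mul_mul_eq_iff (isUnit_det_inv_mul hη₀ hG₀ hη₁ hG₁) _ _

include hη₀ hG₀ hη₁ hG₁ in
/-- **`End⁰(X)^{-,L₁} = {A | γA ∈ End⁰(X)^{-,L₀}}`**. [cite: LooijengaLunts1997, §3, p. 14 L64–L68] -/
theorem mem_rosatiSkew_iff_transporter_mul_mem {A : endAlgRat Φ} :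
    A ∈ rosatiSkew Φ G₁ ↔ transporter hη₀ hG₀ hη₁ hG₁ * A ∈ rosatiSkew Φ G₀ := by
  have hγs : rosati G₀ (G₀⁻¹ * G₁) = G₀⁻¹ * G₁ := (inv_mul_mem_symmEndRat hη₀ hG₀ hη₁ hG₁).2
  rw [mem_rosatiSkew_iff, mem_rosatiSkew_iff, Subalgebra.coe_mul, coe_transporter,
    rosati_mul (isUnit_det_of_isRiemannForm hη₀ hG₀), hγs, rosati_eq_conj_inv_mul hη₀ hG₀, ← Matrix.mul_neg]
  exact inv_mul_mul_eq_iff (isUnit_det_inv_mul hη₀ hG₀ hη₁ hG₁) _ _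

end Transporter

/-! ## §4 The polarisations span `NS_ℚ(X)`; the transporters span `End⁰(X)^+` -/

section Span

variable {Φ} {η₀ : E [⋀^Fin 2]→L[ℝ] ℝ} (hη₀ : IsRiemannForm Φ η₀) {G₀ : Matrix ι ι ℚ}
  (hG₀ : G₀.map (Rat.cast : ℚ → ℝ) = latticeGram Φ η₀)

include hη₀ in
/-- **The ample cone is open in `NS(X) ⊗ ℝ`**: for a polarisation `η₀` and any `θ ∈ NS_ℚ(X)`, `N η₀ + m θ` is again a
polarisation for suitable integers `N ≥ 0`, `m > 0` ("`tα + β` is a Kähler class for `t ≫ 0`", the tree's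
`exists_forall_lt_smul_add_mem_kaehlerCone`, with `isRiemannForm_iff_neg_mem_kaehlerCone`).
[cite: Huybrechts2005, §3.2 Exercise 3.2.12] [cite: Lange2023AbelianVarietiesComplex, §2.4.2 (`NS_ℚ(X)`)] -/
theorem exists_isRiemannForm_smul_add {θ : E [⋀^Fin 2]→L[ℝ] ℝ} (hθ : θ ∈ neronSeveriQ Φ) :
    ∃ N m : ℕ, 0 < m ∧ IsRiemannForm Φ ((N : ℚ) • η₀ + (m : ℚ) • θ) := by
  haveI : FiniteDimensional ℂ E := finiteDimensional_complex Φ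
  obtain ⟨m, hm, hmθ⟩ := exists_nsmul_mem_neronSeveriGroup Φ hθ
  have hNS : IsNSForm Φ ((m : ℝ) • θ) := (mem_neronSeveriGroup_iff Φ).1 hmθ
  have hK : -η₀ ∈ kaehlerCone E := (isRiemannForm_iff_neg_mem_kaehlerCone Φ (hη₀.isNSForm Φ)).1 hη₀
  have h11 : -((m : ℝ) • θ) ∈ realOneOneForms E := mem_realOneOneForms_iff.2 fun u v ↦ by
    simp only [ContinuousAlternatingMap.neg_apply, hNS.type_one_one u v]
  obtain ⟨t₀, -, ht⟩ := exists_forall_lt_smul_add_mem_kaehlerCone hK h11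
  obtain ⟨N, hN⟩ := exists_nat_gt t₀
  refine ⟨N, m, hm, ?_⟩
  have hmem : (N : ℝ) • η₀ + (m : ℝ) • θ ∈ neronSeveriGroup Φ := by
    refine (neronSeveriGroup Φ).add_mem ?_ hmθ
    rw [Nat.cast_smul_eq_nsmul]
    exact (neronSeveriGroup Φ).nsmul_mem ((mem_neronSeveriGroup_iff Φ).2 (hη₀.isNSForm Φ)) N
  have hsum : IsNSForm Φ ((N : ℝ) • η₀ + (m : ℝ) • θ) := (mem_neronSeveriGroup_iff Φ).1 hmem
  have hK' : -((N : ℝ) • η₀ + (m : ℝ) • θ) ∈ kaehlerCone E := by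
    have h := ht N hN
    rwa [smul_neg, ← neg_add] at h
  have hR : IsRiemannForm Φ ((N : ℝ) • η₀ + (m : ℝ) • θ) := (isRiemannForm_iff_neg_mem_kaehlerCone Φ hsum).2 hK'
  have e : (N : ℚ) • η₀ + (m : ℚ) • θ = (N : ℝ) • η₀ + (m : ℝ) • θ := by
    rw [Nat.cast_smul_eq_nsmul ℚ, Nat.cast_smul_eq_nsmul ℚ, Nat.cast_smul_eq_nsmul ℝ, Nat.cast_smul_eq_nsmul ℝ]
  rwa [e]

include hη₀ in
/-- **`NS_ℚ(X)` is spanned by the polarisations** of the abelian variety `X` (`θ = m⁻¹((N η₀ + m θ) - N η₀)`).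
[cite: LooijengaLunts1997, §3, p. 14 L66–L68 ("all Rosati involutions")] [cite: Huybrechts2005, §3.2 Exercise 3.2.12] -/
theorem span_setOf_isRiemannForm_eq_neronSeveriQ :
    Submodule.span ℚ {η : E [⋀^Fin 2]→L[ℝ] ℝ | IsRiemannForm Φ η} = neronSeveriQ Φ := by
  refine le_antisymm (Submodule.span_le.2 fun η hη ↦ mem_neronSeveriQ_of_isRiemannForm Φ hη) fun θ hθ ↦ ?_
  obtain ⟨N, m, hm, hR⟩ := exists_isRiemannForm_smul_add hη₀ hθ
  have hm' : (m : ℚ) ≠ 0 := by exact_mod_cast hm.ne'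
  have e : θ = (m : ℚ)⁻¹ • (((N : ℚ) • η₀ + (m : ℚ) • θ) - (N : ℚ) • η₀) := by
    rw [add_sub_cancel_left, smul_smul, inv_mul_cancel₀ hm', one_smul]
  rw [e]
  exact Submodule.smul_mem _ _ (Submodule.sub_mem _ (Submodule.subset_span hR)
    (Submodule.smul_mem _ _ (Submodule.subset_span hη₀)))

variable (Φ) in
/-- **The transporters `γ_L = φ_{L₀}⁻¹ φ_L ∈ End⁰(X)`, `L` a polarisation** (rational representation `G₀⁻¹ G_L`), as a
subset of `End⁰(X)` — the positive cone of `End⁰(X)^+ ≅ NS_ℚ(X)` up to positive rational multiples.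
[cite: LooijengaLunts1997, §3, p. 14 L63–L66] [cite: Milne1999LefschetzClasses, §1 Remark 1.4 (p. 644)] -/
def polTransporters (G₀ : Matrix ι ι ℚ) : Set (endAlgRat Φ) :=
  {γ | ∃ (η : E [⋀^Fin 2]→L[ℝ] ℝ) (G : Matrix ι ι ℚ), IsRiemannForm Φ η ∧ G.map (Rat.cast : ℚ → ℝ) = latticeGram Φ η ∧
    (γ : Matrix ι ι ℚ) = G₀⁻¹ * G}

/-- A transporter lies in the set of transporters. [cite: LooijengaLunts1997, §3, p. 14 L63–L66] -/
theorem transporter_mem_polTransporters {η₁ : E [⋀^Fin 2]→L[ℝ] ℝ} (hη₁ : IsRiemannForm Φ η₁) {G₁ : Matrix ι ι ℚ}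
    (hG₁ : G₁.map (Rat.cast : ℚ → ℝ) = latticeGram Φ η₁) :
    transporter hη₀ hG₀ hη₁ hG₁ ∈ polTransporters Φ G₀ :=
  ⟨η₁, G₁, hη₁, hG₁, rfl⟩

include hη₀ hG₀ in
/-- `1 = γ_{L₀}` is a transporter. [cite: LooijengaLunts1997, §3, p. 14 L63–L66] -/
theorem one_mem_polTransporters : (1 : endAlgRat Φ) ∈ polTransporters Φ G₀ :=
  ⟨η₀, G₀, hη₀, hG₀, by rw [Subalgebra.coe_one, Matrix.nonsing_inv_mul _ (isUnit_det_of_isRiemannForm hη₀ hG₀)]⟩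

include hη₀ hG₀ in
/-- Transporters are `†₀`-symmetric. [cite: Milne1999LefschetzClasses, §1 (p. 642, "`α† = α`")] -/
theorem polTransporters_subset_rosatiSymm : polTransporters Φ G₀ ⊆ rosatiSymm Φ G₀ := by
  rintro γ ⟨η, G, hη, hG, hγ⟩
  rw [show γ = transporter hη₀ hG₀ hη hG from Subtype.ext hγ]
  exact transporter_mem_rosatiSymm hη₀ hG₀ hη hG

include hη₀ hG₀ in
/-- **`End⁰(X)^+` is the `ℚ`-span of the transporters of polarisations** (Lange Prop. 2.4.12 `NS_ℚ(X) ≅ End^s_ℚ(X)`,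
`L ↦ φ_{L₀}⁻¹ φ_L`, composed with "the polarisations span `NS_ℚ(X)`").
[cite: Lange2023AbelianVarietiesComplex, §2.4.2 Prop. 2.4.12] [cite: LooijengaLunts1997, §3, p. 14 L63–L68] -/
theorem span_polTransporters_eq_rosatiSymm : Submodule.span ℚ (polTransporters Φ G₀) = rosatiSymm Φ G₀ := by
  refine le_antisymm (Submodule.span_le.2 (polTransporters_subset_rosatiSymm hη₀ hG₀)) fun B hB ↦ ?_
  have hdet := isUnit_det_of_isRiemannForm hη₀ hG₀
  obtain ⟨θ, hθ⟩ := exists_nsToEnd_eq hη₀.1 hG₀ hdet (mem_rosatiSymm_iff_coe_mem_symmEndRat.1 hB)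
  obtain ⟨N, m, hm, hR⟩ := exists_isRiemannForm_smul_add hη₀ θ.2
  have hη₀NS : η₀ ∈ neronSeveriQ Φ := mem_neronSeveriQ_of_isRiemannForm Φ hη₀
  have h₁ : (N : ℚ) • η₀ ∈ neronSeveriQ Φ := (neronSeveriQ Φ).smul_mem _ hη₀NS
  have h₂ : (m : ℚ) • (θ : E [⋀^Fin 2]→L[ℝ] ℝ) ∈ neronSeveriQ Φ := (neronSeveriQ Φ).smul_mem _ θ.2
  have hμNS : (N : ℚ) • η₀ + (m : ℚ) • (θ : E [⋀^Fin 2]→L[ℝ] ℝ) ∈ neronSeveriQ Φ := (neronSeveriQ Φ).add_mem h₁ h₂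
  have hGμ : (ratGram Φ ((N : ℚ) • η₀ + (m : ℚ) • (θ : E [⋀^Fin 2]→L[ℝ] ℝ))).map (Rat.cast : ℚ → ℝ) =
      latticeGram Φ ((N : ℚ) • η₀ + (m : ℚ) • (θ : E [⋀^Fin 2]→L[ℝ] ℝ)) :=
    map_ratGram Φ hμNS
  have hγ : transporter hη₀ hG₀ hR hGμ ∈ Submodule.span ℚ (polTransporters Φ G₀) :=
    Submodule.subset_span (transporter_mem_polTransporters hη₀ hG₀ hR hGμ)
  have h1 : (1 : endAlgRat Φ) ∈ Submodule.span ℚ (polTransporters Φ G₀) :=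
    Submodule.subset_span (one_mem_polTransporters hη₀ hG₀)
  -- `γ_μ = G₀⁻¹ G_μ = N • 1 + m • B`
  have hcalc : transporter hη₀ hG₀ hR hGμ = (N : ℚ) • (1 : endAlgRat Φ) + (m : ℚ) • B := Subtype.ext (by
    rw [coe_transporter, Subalgebra.coe_add, Subalgebra.coe_smul, Subalgebra.coe_smul, Subalgebra.coe_one, ← hθ,
      nsToEnd_apply, ratGram_add Φ h₁ h₂, ratGram_smul Φ _ hη₀NS, ratGram_smul Φ _ θ.2, ratGram_eq_of_map_eq hη₀.1 hG₀,
      Matrix.mul_add, Matrix.mul_smul, Matrix.mul_smul, Matrix.nonsing_inv_mul _ hdet])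
  have hm' : (m : ℚ) ≠ 0 := by exact_mod_cast hm.ne'
  have e : B = (m : ℚ)⁻¹ • (transporter hη₀ hG₀ hR hGμ - (N : ℚ) • (1 : endAlgRat Φ)) := by
    rw [hcalc, add_sub_cancel_left, smul_smul, inv_mul_cancel₀ hm', one_smul]
  rw [e]
  exact Submodule.smul_mem _ _ (Submodule.sub_mem _ hγ (Submodule.smul_mem _ _ h1))

end Span

/-! ## §5 `𝔲(X)`: the elements anti-invariant under ALL Rosati involutions -/

section Uf

/-- **`𝔲(X)`** ("Let `𝔲(X)` denote the set of elements in `End⁰(X)` that are anti-invariant with respect to all Rosati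
involutions"): the `A ∈ End⁰(X)` with `A† = -A` for the Rosati involution `† = rosati G` of EVERY polarisation `η` of `X`
(`G` its rational Gram matrix). [cite: LooijengaLunts1997, §3, p. 14 L66–L68] -/
def rosatiAntiInvariants : Submodule ℚ (endAlgRat Φ) where
  carrier := {A | ∀ ⦃η : E [⋀^Fin 2]→L[ℝ] ℝ⦄, IsRiemannForm Φ η → ∀ ⦃G : Matrix ι ι ℚ⦄,
    G.map (Rat.cast : ℚ → ℝ) = latticeGram Φ η → rosati G (A : Matrix ι ι ℚ) = -A}
  add_mem' {A B} hA hB η hη G hG := by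
    rw [Subalgebra.coe_add, rosati_add, hA hη hG, hB hη hG, neg_add]
  zero_mem' η hη G hG := by simp [rosati]
  smul_mem' c {A} hA η hη G hG := by
    rw [Subalgebra.coe_smul, rosati_smul, hA hη hG, smul_neg]

variable {Φ}

/-- Membership in `𝔲(X)`: `A ∈ End⁰(X)^{-,L}` for every polarisation `L`. [cite: LooijengaLunts1997, §3, p. 14 L66–L68] -/
theorem mem_rosatiAntiInvariants_iff {A : endAlgRat Φ} :
    A ∈ rosatiAntiInvariants Φ ↔ ∀ ⦃η : E [⋀^Fin 2]→L[ℝ] ℝ⦄, IsRiemannForm Φ η → ∀ ⦃G : Matrix ι ι ℚ⦄,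
      G.map (Rat.cast : ℚ → ℝ) = latticeGram Φ η → A ∈ rosatiSkew Φ G :=
  Iff.rfl

section OnePolarisation

variable {η₀ : E [⋀^Fin 2]→L[ℝ] ℝ} (hη₀ : IsRiemannForm Φ η₀) {G₀ : Matrix ι ι ℚ}
  (hG₀ : G₀.map (Rat.cast : ℚ → ℝ) = latticeGram Φ η₀)
include hη₀ hG₀

/-- `𝔲(X) ⊆ End⁰(X)^{-,L}` for every polarisation `L`. [cite: LooijengaLunts1997, §3, p. 14 L66–L68] -/
theorem rosatiAntiInvariants_le_rosatiSkew : rosatiAntiInvariants Φ ≤ rosatiSkew Φ G₀ := fun _ hA ↦ hA hη₀ hG₀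

/-- **`𝔲(X)` through ONE polarisation: `𝔲(X) = End⁰(X)^{-,L₀} ∩ C(End⁰(X)^{+,L₀})`** — an element is anti-invariant under
all Rosati involutions iff it is `†₀`-anti-invariant and commutes with every `†₀`-symmetric element (since
`†_L = Ad(γ_L⁻¹) ∘ †₀` and the transporters `γ_L` span `End⁰(X)^+`).
[cite: LooijengaLunts1997, §3, p. 14 L63–L68] [cite: Milne1999LefschetzClasses, §1 (p. 642)] -/
theorem mem_rosatiAntiInvariants_iff_forall_commute {A : endAlgRat Φ} :
    A ∈ rosatiAntiInvariants Φ ↔ A ∈ rosatiSkew Φ G₀ ∧ ∀ B ∈ rosatiSymm Φ G₀, A * B = B * A := by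
  constructor
  · intro hA
    have h0 : rosati G₀ (A : Matrix ι ι ℚ) = -A := hA hη₀ hG₀
    refine ⟨h0, ?_⟩
    have key : ∀ γ ∈ polTransporters Φ G₀, A * γ = γ * A := by
      rintro γ ⟨η₁, G₁, hη₁, hG₁, hγ⟩
      have h1 : rosati G₁ (A : Matrix ι ι ℚ) = -A := hA hη₁ hG₁
      rw [rosati_eq_conj_inv_mul hη₀ hG₀, h0, inv_mul_mul_eq_iff (isUnit_det_inv_mul hη₀ hG₀ hη₁ hG₁),
        Matrix.neg_mul, Matrix.mul_neg, neg_inj] at h1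
      exact Subtype.ext (by rw [Subalgebra.coe_mul, Subalgebra.coe_mul, hγ, h1])
    intro B hB
    rw [← span_polTransporters_eq_rosatiSymm hη₀ hG₀] at hB
    refine Submodule.span_induction (p := fun B _ ↦ A * B = B * A) key ?_ ?_ ?_ hB
    · rw [mul_zero, zero_mul]
    · intro x y _ _ hx hy
      rw [mul_add, add_mul, hx, hy]
    · intro c x _ hx
      rw [mul_smul_comm, smul_mul_assoc, hx]
  · rintro ⟨hA0, hcomm⟩ η₁ hη₁ G₁ hG₁
    have h0 : rosati G₀ (A : Matrix ι ι ℚ) = -A := hA0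
    have hc := congrArg Subtype.val (hcomm _ (transporter_mem_rosatiSymm hη₀ hG₀ hη₁ hG₁))
    simp only [Subalgebra.coe_mul, coe_transporter] at hc
    rw [rosati_eq_conj_inv_mul hη₀ hG₀, h0, inv_mul_mul_eq_iff (isUnit_det_inv_mul hη₀ hG₀ hη₁ hG₁),
      Matrix.neg_mul, Matrix.mul_neg, hc]

/-- `𝔲(X)` commutes with `End⁰(X)^{+,L}` for every polarisation `L`. [cite: LooijengaLunts1997, §3, p. 14 L66–L68, (3.6)] -/
theorem mul_comm_of_mem_rosatiAntiInvariants_of_mem_rosatiSymm {A B : endAlgRat Φ} (hA : A ∈ rosatiAntiInvariants Φ)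
    (hB : B ∈ rosatiSymm Φ G₀) : A * B = B * A :=
  ((mem_rosatiAntiInvariants_iff_forall_commute hη₀ hG₀).1 hA).2 B hB

end OnePolarisation

/-- The ring commutator is additive on the right. [folklore] -/
private theorem rlie_add {R : Type*} [Ring R] (a b c : R) : ⁅a, b + c⁆ = ⁅a, b⁆ + ⁅a, c⁆ := by
  simp only [Ring.lie_def]; noncomm_ring

/-- The ring commutator is additive on the left. [folklore] -/
private theorem add_rlie {R : Type*} [Ring R] (a b c : R) : ⁅a + b, c⁆ = ⁅a, c⁆ + ⁅b, c⁆ := by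
  simp only [Ring.lie_def]; noncomm_ring

/-- The ring commutator is `ℚ`-linear on the right. [folklore] -/
private theorem rlie_smul (a b : endAlgRat Φ) (c : ℚ) : ⁅a, c • b⁆ = c • ⁅a, b⁆ := by
  simp only [Ring.lie_def, mul_smul_comm, smul_mul_assoc, smul_sub]

/-- The ring commutator is `ℚ`-linear on the left. [folklore] -/
private theorem smul_rlie (a b : endAlgRat Φ) (c : ℚ) : ⁅c • a, b⁆ = c • ⁅a, b⁆ := by
  simp only [Ring.lie_def, mul_smul_comm, smul_mul_assoc, smul_sub]

/-- The ring commutator is antisymmetric. [folklore] -/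
private theorem rlie_swap {R : Type*} [Ring R] (a b : R) : ⁅a, b⁆ = -⁅b, a⁆ := by
  simp only [Ring.lie_def]; noncomm_ring

/-- The Jacobi identity in derivation form for the ring commutator. [folklore] -/
private theorem rlie_rlie {R : Type*} [Ring R] (a b c : R) : ⁅a, ⁅b, c⁆⁆ = ⁅⁅a, b⁆, c⁆ + ⁅b, ⁅a, c⁆⁆ := by
  simp only [Ring.lie_def]; noncomm_ring

/-- `⁅a, 0⁆ = 0` for the ring commutator. [folklore] -/
private theorem rlie_zero {R : Type*} [Ring R] (a : R) : ⁅a, (0 : R)⁆ = 0 := by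
  simp only [Ring.lie_def, mul_zero, zero_mul, sub_zero]

/-- `T = ½((T + T†) + (T - T†))`. [cite: LooijengaLunts1997, §3, p. 14 L58] -/
private theorem eq_half_smul_add {η : E [⋀^Fin 2]→L[ℝ] ℝ} (hη : IsRiemannForm Φ η) {G : Matrix ι ι ℚ}
    (hG : G.map (Rat.cast : ℚ → ℝ) = latticeGram Φ η) (T : endAlgRat Φ) :
    T = (2 : ℚ)⁻¹ • ((T + rosatiQ hη hG T) + (T - rosatiQ hη hG T)) := by
  rw [add_add_sub_cancel, ← two_smul ℚ T, smul_smul, inv_mul_cancel₀ two_ne_zero, one_smul]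

/-- **"This is clearly a Lie ideal in `End⁰(X)`"**: `⁅End⁰(X), 𝔲(X)⁆ ⊆ 𝔲(X)`. (Through one polarisation: for `A ∈ 𝔲(X)`
and `T = ½(τ + σ)`, `τ ∈ End⁰(X)^+`, `σ ∈ End⁰(X)^-`: `⁅τ, A⁆ = 0`, while `⁅σ, A⁆ ∈ End⁰(X)^-` commutes with every
`β ∈ End⁰(X)^+` because `⁅σ, β⁆ ∈ End⁰(X)^+` does. Without a polarisation the condition is vacuous.)
[cite: LooijengaLunts1997, §3, p. 14 L66–L68] -/
theorem lie_mem_rosatiAntiInvariants (T : endAlgRat Φ) {A : endAlgRat Φ} (hA : A ∈ rosatiAntiInvariants Φ) :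
    ⁅T, A⁆ ∈ rosatiAntiInvariants Φ := by
  by_cases hX : IsAbelianVariety Φ
  · obtain ⟨η₀, hη₀⟩ := hX
    obtain ⟨G₀, hG₀⟩ := hη₀.exists_ratMatrix_latticeGram
    rw [mem_rosatiAntiInvariants_iff_forall_commute hη₀ hG₀] at hA ⊢
    obtain ⟨hAskew, hAcomm⟩ := hA
    obtain ⟨P, hPdef⟩ : ∃ P : endAlgRat Φ, P = T + rosatiQ hη₀ hG₀ T := ⟨_, rfl⟩
    obtain ⟨M, hMdef⟩ : ∃ M : endAlgRat Φ, M = T - rosatiQ hη₀ hG₀ T := ⟨_, rfl⟩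
    have hP : P ∈ rosatiSymm Φ G₀ := hPdef ▸ add_rosatiQ_mem_rosatiSymm hη₀ hG₀ T
    have hM : M ∈ rosatiSkew Φ G₀ := hMdef ▸ sub_rosatiQ_mem_rosatiSkew hη₀ hG₀ T
    have hT : T = (2 : ℚ)⁻¹ • (P + M) := by
      rw [hPdef, hMdef]
      exact eq_half_smul_add hη₀ hG₀ T
    have hPA : ⁅P, A⁆ = 0 := by rw [Ring.lie_def, sub_eq_zero]; exact (hAcomm P hP).symm
    have key : ⁅T, A⁆ = (2 : ℚ)⁻¹ • ⁅M, A⁆ := by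
      conv_lhs => rw [hT]
      rw [smul_rlie, add_rlie, hPA, zero_add]
    rw [key]
    refine ⟨Submodule.smul_mem _ _ (lie_mem_rosatiSkew hη₀ hG₀ hM hAskew), fun B hB ↦ ?_⟩
    rw [smul_mul_assoc, mul_smul_comm]
    congr 1
    have h1 : A * B = B * A := hAcomm B hB
    have h2 : A * ⁅M, B⁆ = ⁅M, B⁆ * A := hAcomm _ (lie_mem_rosatiSymm_of_skew_of_symm hη₀ hG₀ hM hB)
    simp only [Ring.lie_def] at h2 ⊢
    calc (M * A - A * M) * B = M * (A * B) - A * (M * B) := by rw [sub_mul, mul_assoc, mul_assoc]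
      _ = M * (B * A) - A * (M * B) := by rw [h1]
      _ = (M * B - B * M) * A + B * (M * A) - A * (M * B) := by rw [sub_mul, mul_assoc, mul_assoc]; abel
      _ = A * (M * B - B * M) + B * (M * A) - A * (M * B) := by rw [← h2]
      _ = B * (M * A) - (A * B) * M := by rw [mul_sub, mul_assoc]; abel
      _ = B * (M * A) - (B * A) * M := by rw [h1]
      _ = B * (M * A - A * M) := by rw [mul_sub, mul_assoc]
  · intro η hη
    exact absurd ⟨η, hη⟩ hX

/-- Without a polarisation the defining condition of `𝔲(X)` is vacuous (`𝔲(X) = End⁰(X)`); Looijenga–Lunts' `X` is an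
abelian variety. [cite: LooijengaLunts1997, §3, p. 14 L20–L22 ("of an abelian variety `X`")] -/
theorem rosatiAntiInvariants_eq_top_of_not_isAbelianVariety (hX : ¬ IsAbelianVariety Φ) :
    rosatiAntiInvariants Φ = ⊤ :=
  eq_top_iff.2 fun _ _ η hη ↦ absurd ⟨η, hη⟩ hX

section Kills

variable {η₀ : E [⋀^Fin 2]→L[ℝ] ℝ} (hη₀ : IsRiemannForm Φ η₀) {G₀ : Matrix ι ι ℚ}
  (hG₀ : G₀.map (Rat.cast : ℚ → ℝ) = latticeGram Φ η₀)

/-- For a polarisation, `A† = -A` says that `A` kills its Gram matrix under the derivation action `G ↦ ᵗA G + G A` of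
`End(H₁(X; ℚ))` on bilinear forms. [cite: LooijengaLunts1997, §3, p. 16 L85 ("`𝔲(X)` kills the Néron–Severi group")] -/
theorem transpose_mul_add_mul_eq_zero_of_rosati_eq_neg {η : E [⋀^Fin 2]→L[ℝ] ℝ} (hη : IsRiemannForm Φ η)
    {G : Matrix ι ι ℚ} (hG : G.map (Rat.cast : ℚ → ℝ) = latticeGram Φ η) {A : Matrix ι ι ℚ} (hA : rosati G A = -A) :
    Aᵀ * G + G * A = 0 := by
  have h := (rosati_eq_iff (isUnit_det_of_isRiemannForm hη hG) _ _).1 hA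
  rw [Matrix.mul_neg] at h
  rw [h, neg_add_cancel]

include hη₀ in
/-- **"`𝔲(X)` kills the Néron–Severi group"**: `A ∈ 𝔲(X)` iff `ᵗA G_θ + G_θ A = 0` for EVERY `θ ∈ NS_ℚ(X)` (`G_θ` the
rational Gram matrix of `θ` on the lattice basis) — the derivation action of `End(H₁(X; ℚ))` on `⋀² H¹(X; ℚ) ⊇ NS_ℚ(X)`;
for the polarisations this is `A†_θ = -A`, and the polarisations span `NS_ℚ(X)`.
[cite: LooijengaLunts1997, §3, p. 16 L85–L86] [cite: LooijengaLunts1997, §3, p. 14 L66–L68] -/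
theorem mem_rosatiAntiInvariants_iff_forall_neronSeveriQ {A : endAlgRat Φ} :
    A ∈ rosatiAntiInvariants Φ ↔
      ∀ θ ∈ neronSeveriQ Φ, (A : Matrix ι ι ℚ)ᵀ * ratGram Φ θ + ratGram Φ θ * A = 0 := by
  constructor
  · intro hA θ hθ
    obtain ⟨N, m, hm, hR⟩ := exists_isRiemannForm_smul_add hη₀ hθ
    have hη₀NS : η₀ ∈ neronSeveriQ Φ := mem_neronSeveriQ_of_isRiemannForm Φ hη₀
    have h₁ : (N : ℚ) • η₀ ∈ neronSeveriQ Φ := (neronSeveriQ Φ).smul_mem _ hη₀NS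
    have h₂ : (m : ℚ) • θ ∈ neronSeveriQ Φ := (neronSeveriQ Φ).smul_mem _ hθ
    have hμNS : (N : ℚ) • η₀ + (m : ℚ) • θ ∈ neronSeveriQ Φ := (neronSeveriQ Φ).add_mem h₁ h₂
    have kμ := transpose_mul_add_mul_eq_zero_of_rosati_eq_neg hR (map_ratGram Φ hμNS) (hA hR (map_ratGram Φ hμNS))
    have k₀ := transpose_mul_add_mul_eq_zero_of_rosati_eq_neg hη₀ (map_ratGram Φ hη₀NS) (hA hη₀ (map_ratGram Φ hη₀NS))
    rw [ratGram_add Φ h₁ h₂, ratGram_smul Φ _ hη₀NS, ratGram_smul Φ _ hθ, Matrix.mul_add, Matrix.add_mul,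
      Matrix.mul_smul, Matrix.smul_mul, Matrix.mul_smul, Matrix.smul_mul, add_add_add_comm, ← smul_add, ← smul_add, k₀,
      smul_zero, zero_add, smul_eq_zero] at kμ
    exact kμ.resolve_left (by exact_mod_cast hm.ne')
  · intro h η hη G hG
    have hGu := isUnit_det_of_isRiemannForm hη hG
    rw [rosati_eq_iff hGu, Matrix.mul_neg, eq_neg_iff_add_eq_zero, eq_ratGram_of_isRiemannForm hη hG]
    exact h η (mem_neronSeveriQ_of_isRiemannForm Φ hη)

omit [Fintype ι] [DecidableEq ι] in
/-- Realification commutes with matrix products. [folklore] -/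
private theorem map_ratCast_mul₀ [Fintype ι] (A B : Matrix ι ι ℚ) :
    (A * B).map (Rat.cast : ℚ → ℝ) = A.map (Rat.cast : ℚ → ℝ) * B.map (Rat.cast : ℚ → ℝ) := by
  rw [show (Rat.cast : ℚ → ℝ) = ⇑(Rat.castHom ℝ) from rfl, Matrix.map_mul]

omit [DecidableEq ι] in
/-- `θ(Φ(Mx), Φy) + θ(Φx, Φ(My)) = ᵗx (ᵗM G + G M) y` for the real Gram matrix `G` of `θ`. [cite: Lange2023AbelianVarietiesComplex, §1.5.1] -/
theorem apply_mulVec_add_apply_mulVec [DecidableEq ι] (θ : E [⋀^Fin 2]→L[ℝ] ℝ) (M : Matrix ι ι ℝ) (x y : ι → ℝ) :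
    θ ![Φ (M *ᵥ x), Φ y] + θ ![Φ x, Φ (M *ᵥ y)] = x ⬝ᵥ ((Mᵀ * latticeGram Φ θ + latticeGram Φ θ * M) *ᵥ y) := by
  rw [← dotProduct_latticeGram_mulVec, ← dotProduct_latticeGram_mulVec, Matrix.add_mulVec, dotProduct_add,
    ← Matrix.mulVec_mulVec, ← Matrix.mulVec_mulVec, Matrix.dotProduct_mulVec x Mᵀ, Matrix.vecMul_transpose]

include hη₀ in
/-- **"`𝔲(X)` kills the Néron–Severi group"**, on the forms: for `A ∈ 𝔲(X)` (real action `ρ_r(A)` on `H₁(X; ℝ) = ℝ^ι`)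
and every `θ ∈ NS_ℚ(X)`, `θ(ρ_r(A)u, v) + θ(u, ρ_r(A)v) = 0` — the derivation `D_A` of `⋀² H¹(X; ℝ)` kills `θ`.
[cite: LooijengaLunts1997, §3, p. 16 L85–L86] -/
theorem apply_mulVec_add_apply_mulVec_eq_zero {A : endAlgRat Φ} (hA : A ∈ rosatiAntiInvariants Φ)
    {θ : E [⋀^Fin 2]→L[ℝ] ℝ} (hθ : θ ∈ neronSeveriQ Φ) (x y : ι → ℝ) :
    θ ![Φ ((A : Matrix ι ι ℚ).map (Rat.cast : ℚ → ℝ) *ᵥ x), Φ y] +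
      θ ![Φ x, Φ ((A : Matrix ι ι ℚ).map (Rat.cast : ℚ → ℝ) *ᵥ y)] = 0 := by
  have h := (mem_rosatiAntiInvariants_iff_forall_neronSeveriQ hη₀).1 hA θ hθ
  have h' : ((A : Matrix ι ι ℚ).map (Rat.cast : ℚ → ℝ))ᵀ * latticeGram Φ θ +
      latticeGram Φ θ * (A : Matrix ι ι ℚ).map (Rat.cast : ℚ → ℝ) = 0 := by
    rw [← map_ratGram Φ hθ, ← Matrix.transpose_map, ← map_ratCast_mul₀, ← map_ratCast_mul₀,
      ← Matrix.map_add (Rat.cast : ℚ → ℝ) Rat.cast_add, h, Matrix.map_zero _ Rat.cast_zero]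
  rw [apply_mulVec_add_apply_mulVec, h', Matrix.zero_mulVec, dotProduct_zero]

end Kills

end Uf

/-! ## §6 The span `S` of the Rosati-fixed elements, the Lie ideal `I` generated by `End⁰(X)^+`, and
`End⁰(X) = I ⊕ 𝔲(X)` -/

section Decomposition

/-- **"the span of the elements fixed by some Rosati involution"**: `S = Σ_L End⁰(X)^{+,L}` over all polarisations `L`.
[cite: LooijengaLunts1997, §3, proof of (3.6), p. 14 L92–L93] -/
def rosatiSymmSpan : Submodule ℚ (endAlgRat Φ) :=
  Submodule.span ℚ {A | ∃ (η : E [⋀^Fin 2]→L[ℝ] ℝ) (G : Matrix ι ι ℚ), IsRiemannForm Φ η ∧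
    G.map (Rat.cast : ℚ → ℝ) = latticeGram Φ η ∧ rosati G (A : Matrix ι ι ℚ) = A}

/-- **"the Lie ideal of `End⁰(X)` that is generated by `End⁰(X)^+`"**, for the Rosati involution of one polarisation with
rational Gram matrix `G`: `I = End⁰(X)^+ + [End⁰(X)^+, End⁰(X)^+]` — it contains `End⁰(X)^+`, is stable under
`⁅End⁰(X), ·⁆` (`lie_mem_rosatiSymmIdeal`) and is the smallest such subspace (`rosatiSymmIdeal_le`).
[cite: LooijengaLunts1997, §3, (3.6) Proposition, p. 14 L73–L74] -/
def rosatiSymmIdeal (G : Matrix ι ι ℚ) : Submodule ℚ (endAlgRat Φ) :=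
  rosatiSymm Φ G ⊔ Submodule.span ℚ {C | ∃ A ∈ rosatiSymm Φ G, ∃ B ∈ rosatiSymm Φ G, C = ⁅A, B⁆}

variable {Φ}

/-- `End⁰(X)^{+,L} ⊆ S` for every polarisation `L`. [cite: LooijengaLunts1997, §3, proof of (3.6), p. 14 L92–L93] -/
theorem rosatiSymm_le_rosatiSymmSpan {η : E [⋀^Fin 2]→L[ℝ] ℝ} (hη : IsRiemannForm Φ η) {G : Matrix ι ι ℚ}
    (hG : G.map (Rat.cast : ℚ → ℝ) = latticeGram Φ η) : rosatiSymm Φ G ≤ rosatiSymmSpan Φ :=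
  fun _ hA ↦ Submodule.subset_span ⟨η, G, hη, hG, hA⟩

/-- **"So `𝔲(X)` is the orthogonal complement of the span of the elements fixed by some Rosati involution"**:
`𝔲(X) = S^⊥` for the `ℚ`-trace form (from `End⁰(X)^{-,L} = (End⁰(X)^{+,L})^⊥` for each polarisation `L`).
[cite: LooijengaLunts1997, §3, proof of (3.6), p. 14 L92–L93] -/
theorem rosatiAntiInvariants_eq_orthogonal_rosatiSymmSpan :
    rosatiAntiInvariants Φ = (endTraceForm Φ).orthogonal (rosatiSymmSpan Φ) := by
  refine le_antisymm (fun A hA ↦ ?_) (fun A hA η hη G hG ↦ ?_)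
  · rw [LinearMap.BilinForm.mem_orthogonal_iff]
    intro n hn
    show endTraceForm Φ n A = 0
    refine Submodule.span_induction (p := fun n _ ↦ endTraceForm Φ n A = 0) ?_ ?_ ?_ ?_ hn
    · rintro B ⟨η, G, hη, hG, hB⟩
      exact endTraceForm_eq_zero_of_mem_rosatiSymm_of_mem_rosatiSkew hη hG hB (hA hη hG)
    · rw [map_zero, LinearMap.zero_apply]
    · intro x y _ _ hx hy
      rw [map_add, LinearMap.add_apply, hx, hy, add_zero]
    · intro c x _ hx
      rw [map_smul, LinearMap.smul_apply, hx, smul_zero]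
  · rw [LinearMap.BilinForm.mem_orthogonal_iff] at hA
    exact (mem_rosatiSkew_iff_forall_endTraceForm_eq_zero hη hG).2 fun B hB ↦ hA B (rosatiSymm_le_rosatiSymmSpan hη hG hB)

variable {G : Matrix ι ι ℚ}

/-- `End⁰(X)^+ ⊆ I`. [cite: LooijengaLunts1997, §3, (3.6), p. 14 L73–L74] -/
theorem rosatiSymm_le_rosatiSymmIdeal : rosatiSymm Φ G ≤ rosatiSymmIdeal Φ G :=
  le_sup_left

/-- `⁅A, B⁆ ∈ I` for `A, B ∈ End⁰(X)^+`. [cite: LooijengaLunts1997, §3, (3.6), p. 14 L73–L74] -/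
theorem lie_mem_rosatiSymmIdeal_of_mem_rosatiSymm {A B : endAlgRat Φ} (hA : A ∈ rosatiSymm Φ G)
    (hB : B ∈ rosatiSymm Φ G) : ⁅A, B⁆ ∈ rosatiSymmIdeal Φ G :=
  Submodule.mem_sup_right (Submodule.subset_span ⟨A, hA, B, hB, rfl⟩)

/-- **`I` is the SMALLEST subspace of `End⁰(X)` containing `End⁰(X)^+` and stable under `⁅End⁰(X), ·⁆`** ("generated by").
[cite: LooijengaLunts1997, §3, (3.6), p. 14 L73–L74] -/
theorem rosatiSymmIdeal_le {N : Submodule ℚ (endAlgRat Φ)} (h₁ : rosatiSymm Φ G ≤ N)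
    (h₂ : ∀ (T C : endAlgRat Φ), C ∈ N → ⁅T, C⁆ ∈ N) : rosatiSymmIdeal Φ G ≤ N :=
  sup_le h₁ (Submodule.span_le.2 (by
    rintro C ⟨A, hA, B, hB, rfl⟩
    exact h₂ A B (h₁ hB)))

section OnePolarisation

variable {η₀ : E [⋀^Fin 2]→L[ℝ] ℝ} (hη₀ : IsRiemannForm Φ η₀) {G₀ : Matrix ι ι ℚ}
  (hG₀ : G₀.map (Rat.cast : ℚ → ℝ) = latticeGram Φ η₀)
include hη₀ hG₀

/-- **`I` is a Lie ideal of `End⁰(X)`**: `⁅T, I⁆ ⊆ I` for every `T ∈ End⁰(X)` (write `T = ½(τ + σ)`; `⁅τ, E^+⁆ ⊆ [E^+, E^+]`,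
`⁅τ, ⁅α, β⁆⁆ ∈ [E^+, E^-] ⊆ E^+`, `⁅σ, E^+⁆ ⊆ E^+`, `⁅σ, ⁅α, β⁆⁆ = ⁅⁅σ, α⁆, β⁆ + ⁅α, ⁅σ, β⁆⁆ ∈ [E^+, E^+]`).
[cite: LooijengaLunts1997, §3, (3.6), p. 14 L73–L74] -/
theorem lie_mem_rosatiSymmIdeal (T : endAlgRat Φ) {C : endAlgRat Φ} (hC : C ∈ rosatiSymmIdeal Φ G₀) :
    ⁅T, C⁆ ∈ rosatiSymmIdeal Φ G₀ := by
  -- first for `S` symmetric or skew, then `T = ½((T + T†) + (T - T†))`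
  have key : ∀ S : endAlgRat Φ, (S ∈ rosatiSymm Φ G₀ ∨ S ∈ rosatiSkew Φ G₀) → ∀ C ∈ rosatiSymmIdeal Φ G₀,
      ⁅S, C⁆ ∈ rosatiSymmIdeal Φ G₀ := by
    intro S hS C hC
    obtain ⟨C₁, hC₁, C₂, hC₂, rfl⟩ := Submodule.mem_sup.1 hC
    rw [rlie_add]
    refine add_mem ?_ ?_
    · rcases hS with hS | hS
      · exact lie_mem_rosatiSymmIdeal_of_mem_rosatiSymm hS hC₁
      · exact rosatiSymm_le_rosatiSymmIdeal (lie_mem_rosatiSymm_of_skew_of_symm hη₀ hG₀ hS hC₁)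
    · refine Submodule.span_induction (p := fun C _ ↦ ⁅S, C⁆ ∈ rosatiSymmIdeal Φ G₀) ?_ ?_ ?_ ?_ hC₂
      · rintro D ⟨A, hA, B, hB, rfl⟩
        rcases hS with hS | hS
        · -- `⁅τ, ⁅A, B⁆⁆ = -⁅⁅A, B⁆, τ⁆ ∈ E^+`
          rw [rlie_swap]
          exact neg_mem (rosatiSymm_le_rosatiSymmIdeal
            (lie_mem_rosatiSymm_of_skew_of_symm hη₀ hG₀ (lie_mem_rosatiSkew_of_symm_of_symm hη₀ hG₀ hA hB) hS))
        · -- `⁅σ, ⁅A, B⁆⁆ = ⁅⁅σ, A⁆, B⁆ + ⁅A, ⁅σ, B⁆⁆`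
          rw [rlie_rlie]
          exact add_mem
            (lie_mem_rosatiSymmIdeal_of_mem_rosatiSymm (lie_mem_rosatiSymm_of_skew_of_symm hη₀ hG₀ hS hA) hB)
            (lie_mem_rosatiSymmIdeal_of_mem_rosatiSymm hA (lie_mem_rosatiSymm_of_skew_of_symm hη₀ hG₀ hS hB))
      · rw [rlie_zero]
        exact zero_mem _
      · intro x y _ _ hx hy
        rw [rlie_add]
        exact add_mem hx hy
      · intro c x _ hx
        rw [rlie_smul]
        exact Submodule.smul_mem _ _ hx
  rw [eq_half_smul_add hη₀ hG₀ T, smul_rlie, add_rlie]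
  exact Submodule.smul_mem _ _ (add_mem (key _ (Or.inl (add_rosatiQ_mem_rosatiSymm hη₀ hG₀ T)) C hC)
    (key _ (Or.inr (sub_rosatiQ_mem_rosatiSkew hη₀ hG₀ T)) C hC))

/-- Products of `†₀`-symmetric elements lie in `I`: `AB = ½(AB + BA) + ½⁅A, B⁆`.
[cite: LooijengaLunts1997, §3, (3.6), p. 14 L73–L74] -/
theorem mul_mem_rosatiSymmIdeal {A B : endAlgRat Φ} (hA : A ∈ rosatiSymm Φ G₀) (hB : B ∈ rosatiSymm Φ G₀) :
    A * B ∈ rosatiSymmIdeal Φ G₀ := by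
  have e : A * B = (2 : ℚ)⁻¹ • (A * B + B * A) + (2 : ℚ)⁻¹ • ⁅A, B⁆ := by
    rw [Ring.lie_def, ← smul_add, add_add_sub_cancel, ← two_smul ℚ (A * B), smul_smul, inv_mul_cancel₀ two_ne_zero,
      one_smul]
  rw [e]
  exact add_mem (Submodule.smul_mem _ _ (rosatiSymm_le_rosatiSymmIdeal (mul_add_mul_mem_rosatiSymm hη₀ hG₀ hA hB)))
    (Submodule.smul_mem _ _ (lie_mem_rosatiSymmIdeal_of_mem_rosatiSymm hA hB))

/-- **`I` is the span of the products `End⁰(X)^+ · End⁰(X)^+`.** [cite: LooijengaLunts1997, §3, (3.6), p. 14 L73–L74] -/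
theorem rosatiSymmIdeal_eq_span_mul :
    rosatiSymmIdeal Φ G₀ = Submodule.span ℚ {C | ∃ A ∈ rosatiSymm Φ G₀, ∃ B ∈ rosatiSymm Φ G₀, C = A * B} := by
  refine le_antisymm (sup_le (fun A hA ↦ ?_) (Submodule.span_le.2 ?_)) (Submodule.span_le.2 ?_)
  · exact Submodule.subset_span ⟨A, hA, 1, one_mem_rosatiSymm hη₀ hG₀, (mul_one A).symm⟩
  · rintro C ⟨A, hA, B, hB, rfl⟩
    rw [Ring.lie_def]
    exact sub_mem (Submodule.subset_span ⟨A, hA, B, hB, rfl⟩) (Submodule.subset_span ⟨B, hB, A, hA, rfl⟩)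
  · rintro C ⟨A, hA, B, hB, rfl⟩
    exact mul_mem_rosatiSymmIdeal hη₀ hG₀ hA hB

/-- For a second polarisation `L₁` with transporter `γ`: `βγ ∈ End⁰(X)^{+,L₁}` for every `β ∈ End⁰(X)^{+,L₀}`
(`γ(βγ) = γβγ` is `†₀`-symmetric). [cite: LooijengaLunts1997, §3, p. 14 L63–L66] -/
theorem mul_transporter_mem_rosatiSymm {η₁ : E [⋀^Fin 2]→L[ℝ] ℝ} (hη₁ : IsRiemannForm Φ η₁) {G₁ : Matrix ι ι ℚ}
    (hG₁ : G₁.map (Rat.cast : ℚ → ℝ) = latticeGram Φ η₁) {B : endAlgRat Φ} (hB : B ∈ rosatiSymm Φ G₀) :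
    B * transporter hη₀ hG₀ hη₁ hG₁ ∈ rosatiSymm Φ G₁ := by
  have hdet := isUnit_det_of_isRiemannForm hη₀ hG₀
  have hγs : rosati G₀ (G₀⁻¹ * G₁) = G₀⁻¹ * G₁ := (inv_mul_mem_symmEndRat hη₀ hG₀ hη₁ hG₁).2
  rw [mem_rosatiSymm_iff_transporter_mul_mem hη₀ hG₀ hη₁ hG₁, mem_rosatiSymm_iff]
  rw [mem_rosatiSymm_iff] at hB
  simp only [Subalgebra.coe_mul, coe_transporter]
  rw [rosati_mul hdet, rosati_mul hdet, hB, hγs, Matrix.mul_assoc]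

/-- The transporter back, `γ' = φ_{L₁}⁻¹ φ_{L₀} = γ⁻¹`, is `†₀`-symmetric too. [cite: Milne1999LefschetzClasses, §1 (p. 642)] -/
theorem transporter_symm_mem_rosatiSymm {η₁ : E [⋀^Fin 2]→L[ℝ] ℝ} (hη₁ : IsRiemannForm Φ η₁) {G₁ : Matrix ι ι ℚ}
    (hG₁ : G₁.map (Rat.cast : ℚ → ℝ) = latticeGram Φ η₁) :
    transporter hη₁ hG₁ hη₀ hG₀ ∈ rosatiSymm Φ G₀ := by
  -- `γ' ∈ E^{+,0} ⟺ γ'(γ') ∈ E^{+,1}`, and `γ'` is `†₁`-symmetric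
  rw [mem_rosatiSymm_iff_transporter_mul_mem hη₁ hG₁ hη₀ hG₀, mem_rosatiSymm_iff]
  have h := mem_rosatiSymm_iff.1 (transporter_mem_rosatiSymm hη₁ hG₁ hη₀ hG₀)
  rw [Subalgebra.coe_mul, rosati_mul (isUnit_det_of_isRiemannForm hη₁ hG₁), h]

/-- `γ' γ = 1` for the transporter `γ` and the transporter back `γ'`. [cite: Lange2023AbelianVarietiesComplex, §2.4.2 Prop. 2.4.12] -/
theorem transporter_symm_mul_transporter {η₁ : E [⋀^Fin 2]→L[ℝ] ℝ} (hη₁ : IsRiemannForm Φ η₁) {G₁ : Matrix ι ι ℚ}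
    (hG₁ : G₁.map (Rat.cast : ℚ → ℝ) = latticeGram Φ η₁) :
    transporter hη₁ hG₁ hη₀ hG₀ * transporter hη₀ hG₀ hη₁ hG₁ = 1 :=
  Subtype.ext (by
    rw [Subalgebra.coe_mul, coe_transporter, coe_transporter, Subalgebra.coe_one, Matrix.mul_assoc,
      Matrix.mul_nonsing_inv_cancel_left _ _ (isUnit_det_of_isRiemannForm hη₀ hG₀),
      Matrix.nonsing_inv_mul _ (isUnit_det_of_isRiemannForm hη₁ hG₁)])

/-- `I ⊆ S`: `αβ ∈ S` for `α, β ∈ End⁰(X)^{+,L₀}` (`β` is a combination of transporters `γ`, and `αγ ∈ End⁰(X)^{+,L_γ}`).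
[cite: LooijengaLunts1997, §3, proof of (3.6), p. 14 L92–L94] -/
theorem rosatiSymmIdeal_le_rosatiSymmSpan : rosatiSymmIdeal Φ G₀ ≤ rosatiSymmSpan Φ := by
  rw [rosatiSymmIdeal_eq_span_mul hη₀ hG₀]
  refine Submodule.span_le.2 ?_
  rintro C ⟨A, hA, B, hB, rfl⟩
  rw [← span_polTransporters_eq_rosatiSymm hη₀ hG₀] at hB
  refine Submodule.span_induction (p := fun B _ ↦ A * B ∈ rosatiSymmSpan Φ) ?_ ?_ ?_ ?_ hB
  · rintro γ ⟨η₁, G₁, hη₁, hG₁, hγ⟩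
    rw [show γ = transporter hη₀ hG₀ hη₁ hG₁ from Subtype.ext hγ]
    exact rosatiSymm_le_rosatiSymmSpan hη₁ hG₁ (mul_transporter_mem_rosatiSymm hη₀ hG₀ hη₁ hG₁ hA)
  · rw [mul_zero]
    exact zero_mem _
  · intro x y _ _ hx hy
    rw [mul_add]
    exact add_mem hx hy
  · intro c x _ hx
    rw [mul_smul_comm]
    exact Submodule.smul_mem _ _ hx

/-- `S ⊆ I`: an `L₁`-symmetric `A` is `γ'(γA)` with `γA, γ' ∈ End⁰(X)^{+,L₀}`.
[cite: LooijengaLunts1997, §3, proof of (3.6), p. 14 L92–L94] -/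
theorem rosatiSymmSpan_le_rosatiSymmIdeal : rosatiSymmSpan Φ ≤ rosatiSymmIdeal Φ G₀ := by
  refine Submodule.span_le.2 ?_
  rintro A ⟨η₁, G₁, hη₁, hG₁, hA⟩
  have hγA := (mem_rosatiSymm_iff_transporter_mul_mem hη₀ hG₀ hη₁ hG₁).1 (mem_rosatiSymm_iff.2 hA)
  have e : A = transporter hη₁ hG₁ hη₀ hG₀ * (transporter hη₀ hG₀ hη₁ hG₁ * A) := by
    rw [← mul_assoc, transporter_symm_mul_transporter hη₀ hG₀ hη₁ hG₁, one_mul]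
  rw [e]
  exact mul_mem_rosatiSymmIdeal hη₀ hG₀ (transporter_symm_mem_rosatiSymm hη₀ hG₀ hη₁ hG₁) hγA

/-- **`I = S`**: the Lie ideal generated by `End⁰(X)^{+,L₀}` is the span of the elements fixed by some Rosati involution;
in particular it does not depend on `L₀`. [cite: LooijengaLunts1997, §3, proof of (3.6), p. 14 L92–L94] -/
theorem rosatiSymmIdeal_eq_rosatiSymmSpan : rosatiSymmIdeal Φ G₀ = rosatiSymmSpan Φ :=
  le_antisymm (rosatiSymmIdeal_le_rosatiSymmSpan hη₀ hG₀) (rosatiSymmSpan_le_rosatiSymmIdeal hη₀ hG₀)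

/-- `I` does not depend on the polarisation. [cite: LooijengaLunts1997, §3, (3.6), p. 14 L73–L74] -/
theorem rosatiSymmIdeal_eq_rosatiSymmIdeal {η₁ : E [⋀^Fin 2]→L[ℝ] ℝ} (hη₁ : IsRiemannForm Φ η₁) {G₁ : Matrix ι ι ℚ}
    (hG₁ : G₁.map (Rat.cast : ℚ → ℝ) = latticeGram Φ η₁) : rosatiSymmIdeal Φ G₀ = rosatiSymmIdeal Φ G₁ := by
  rw [rosatiSymmIdeal_eq_rosatiSymmSpan hη₀ hG₀, rosatiSymmIdeal_eq_rosatiSymmSpan hη₁ hG₁]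

/-- **`𝔲(X) = I^⊥`** for the `ℚ`-trace form. [cite: LooijengaLunts1997, §3, proof of (3.6), p. 14 L92–L94] -/
theorem rosatiAntiInvariants_eq_orthogonal_rosatiSymmIdeal :
    rosatiAntiInvariants Φ = (endTraceForm Φ).orthogonal (rosatiSymmIdeal Φ G₀) := by
  rw [rosatiSymmIdeal_eq_rosatiSymmSpan hη₀ hG₀, rosatiAntiInvariants_eq_orthogonal_rosatiSymmSpan]

/-- **"This orthoplement is an ideal as well"**: `S` (`= I`) is stable under `⁅End⁰(X), ·⁆`, like its orthoplement `𝔲(X)`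
(`lie_mem_rosatiAntiInvariants`). [cite: LooijengaLunts1997, §3, proof of (3.6), p. 14 L93–L94] -/
theorem lie_mem_rosatiSymmSpan (T : endAlgRat Φ) {C : endAlgRat Φ} (hC : C ∈ rosatiSymmSpan Φ) :
    ⁅T, C⁆ ∈ rosatiSymmSpan Φ := by
  rw [← rosatiSymmIdeal_eq_rosatiSymmSpan hη₀ hG₀] at hC ⊢
  exact lie_mem_rosatiSymmIdeal hη₀ hG₀ T hC

/-- **`I ∩ 𝔲(X) = 0`** (positivity: `A ∈ I ∩ I^⊥` with `A†₀ = -A` gives `Tr(A†₀ A) = -Tr(AA) = 0`, so `A = 0`).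
[cite: LooijengaLunts1997, §3, (3.6), p. 14 L76] [cite: Lange2023AbelianVarietiesComplex, §2.4.1 Theorem 2.4.9] -/
theorem disjoint_rosatiSymmIdeal_rosatiAntiInvariants : Disjoint (rosatiSymmIdeal Φ G₀) (rosatiAntiInvariants Φ) := by
  rw [Submodule.disjoint_def]
  intro A hI hU
  have horth : A ∈ (endTraceForm Φ).orthogonal (rosatiSymmIdeal Φ G₀) := by
    rw [← rosatiAntiInvariants_eq_orthogonal_rosatiSymmIdeal hη₀ hG₀]
    exact hU
  have h0 : endTraceForm Φ A A = 0 := (LinearMap.BilinForm.mem_orthogonal_iff.1 horth) A hI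
  exact eq_zero_of_mem_rosatiSkew_of_endTraceForm_self_eq_zero hη₀ hG₀ (rosatiAntiInvariants_le_rosatiSkew hη₀ hG₀ hU) h0

/-- **Looijenga–Lunts (3.6), last clause: `End⁰(X) = I ⊕ 𝔲(X)`** — `End⁰(X)` is the direct sum of the Lie ideal generated
by `End⁰(X)^+` and the Lie ideal `𝔲(X)` of the Rosati anti-invariants (complementary subspaces; both are Lie ideals,
`lie_mem_rosatiSymmIdeal`, `lie_mem_rosatiAntiInvariants`, and they commute, `mul_comm_of_mem_rosatiSymmIdeal_of_mem_rosatiAntiInvariants`,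
so the sum is a product of Lie algebras). [cite: LooijengaLunts1997, §3, (3.6) Proposition, p. 14 L76 ("Moreover, `End⁰(X) = 𝔤_NS(X; ℚ)_0 × 𝔲(X)`")] -/
theorem isCompl_rosatiSymmIdeal_rosatiAntiInvariants : IsCompl (rosatiSymmIdeal Φ G₀) (rosatiAntiInvariants Φ) := by
  have hd := disjoint_rosatiSymmIdeal_rosatiAntiInvariants hη₀ hG₀
  rw [rosatiAntiInvariants_eq_orthogonal_rosatiSymmIdeal hη₀ hG₀] at hd ⊢
  exact (LinearMap.BilinForm.isCompl_orthogonal_iff_disjoint (V := endAlgRat Φ) isRefl_endTraceForm).2 hd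

/-- `I + 𝔲(X) = End⁰(X)`. [cite: LooijengaLunts1997, §3, (3.6) Proposition, p. 14 L76] -/
theorem rosatiSymmIdeal_sup_rosatiAntiInvariants_eq_top : rosatiSymmIdeal Φ G₀ ⊔ rosatiAntiInvariants Φ = ⊤ :=
  (isCompl_rosatiSymmIdeal_rosatiAntiInvariants hη₀ hG₀).sup_eq_top

/-- `I ∩ 𝔲(X) = 0`. [cite: LooijengaLunts1997, §3, (3.6) Proposition, p. 14 L76] -/
theorem rosatiSymmIdeal_inf_rosatiAntiInvariants_eq_bot : rosatiSymmIdeal Φ G₀ ⊓ rosatiAntiInvariants Φ = ⊥ :=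
  (isCompl_rosatiSymmIdeal_rosatiAntiInvariants hη₀ hG₀).inf_eq_bot

/-- Every `T ∈ End⁰(X)` is uniquely `T = C + A` with `C ∈ I`, `A ∈ 𝔲(X)`. [cite: LooijengaLunts1997, §3, (3.6), p. 14 L76] -/
theorem existsUnique_add_eq (T : endAlgRat Φ) :
    ∃! p : (rosatiSymmIdeal Φ G₀) × (rosatiAntiInvariants Φ), (p.1 : endAlgRat Φ) + p.2 = T := by
  have h := isCompl_rosatiSymmIdeal_rosatiAntiInvariants hη₀ hG₀
  obtain ⟨C, A, hT⟩ : ∃ (C : rosatiSymmIdeal Φ G₀) (A : rosatiAntiInvariants Φ), (C : endAlgRat Φ) + A = T := by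
    have hT : T ∈ rosatiSymmIdeal Φ G₀ ⊔ rosatiAntiInvariants Φ := by rw [h.sup_eq_top]; exact Submodule.mem_top
    obtain ⟨C, hC, A, hA, e⟩ := Submodule.mem_sup.1 hT
    exact ⟨⟨C, hC⟩, ⟨A, hA⟩, e⟩
  refine ⟨(C, A), hT, ?_⟩
  rintro ⟨C', A'⟩ hT'
  have e : (C : endAlgRat Φ) - C' = (A' : endAlgRat Φ) - A := by
    rw [sub_eq_sub_iff_add_eq_add, hT, add_comm, hT']
  have hmem : (C : endAlgRat Φ) - C' ∈ rosatiSymmIdeal Φ G₀ ⊓ rosatiAntiInvariants Φ :=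
    Submodule.mem_inf.2 ⟨sub_mem C.2 C'.2, by rw [e]; exact sub_mem A'.2 A.2⟩
  rw [h.inf_eq_bot, Submodule.mem_bot, sub_eq_zero] at hmem
  have hA : (A' : endAlgRat Φ) = A := by
    have := e; rw [hmem, sub_self, eq_comm, sub_eq_zero] at this; exact this
  exact Prod.ext (Subtype.ext hmem.symm) (Subtype.ext hA)

/-- **`dim I + dim 𝔲(X) = dim End⁰(X)`.** [cite: LooijengaLunts1997, §3, (3.6) Proposition, p. 14 L76] -/
theorem finrank_rosatiSymmIdeal_add_finrank_rosatiAntiInvariants :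
    Module.finrank ℚ (rosatiSymmIdeal Φ G₀) + Module.finrank ℚ (rosatiAntiInvariants Φ) =
      Module.finrank ℚ (endAlgRat Φ) :=
  Submodule.finrank_add_eq_of_isCompl (isCompl_rosatiSymmIdeal_rosatiAntiInvariants hη₀ hG₀)

/-- **`[I, 𝔲(X)] = 0`: the two Lie ideals commute**, so `End⁰(X) = I × 𝔲(X)` as Lie algebras (`𝔲(X)` commutes with
`End⁰(X)^+`, hence with the span `I` of its products). [cite: LooijengaLunts1997, §3, (3.6) Proposition, p. 14 L76] -/
theorem mul_comm_of_mem_rosatiSymmIdeal_of_mem_rosatiAntiInvariants {C A : endAlgRat Φ} (hC : C ∈ rosatiSymmIdeal Φ G₀)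
    (hA : A ∈ rosatiAntiInvariants Φ) : C * A = A * C := by
  have hcomm := fun (B : endAlgRat Φ) (hB : B ∈ rosatiSymm Φ G₀) ↦
    mul_comm_of_mem_rosatiAntiInvariants_of_mem_rosatiSymm hη₀ hG₀ hA hB
  rw [rosatiSymmIdeal_eq_span_mul hη₀ hG₀] at hC
  refine Submodule.span_induction (p := fun C _ ↦ C * A = A * C) ?_ ?_ ?_ ?_ hC
  · rintro D ⟨B₁, hB₁, B₂, hB₂, rfl⟩
    rw [mul_assoc, ← hcomm B₂ hB₂, ← mul_assoc, ← hcomm B₁ hB₁, mul_assoc]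
  · rw [zero_mul, mul_zero]
  · intro x y _ _ hx hy
    rw [add_mul, mul_add, hx, hy]
  · intro c x _ hx
    rw [smul_mul_assoc, mul_smul_comm, hx]

/-- `⁅I, 𝔲(X)⁆ = 0`. [cite: LooijengaLunts1997, §3, (3.6) Proposition, p. 14 L76] -/
theorem lie_eq_zero_of_mem_rosatiSymmIdeal_of_mem_rosatiAntiInvariants {C A : endAlgRat Φ}
    (hC : C ∈ rosatiSymmIdeal Φ G₀) (hA : A ∈ rosatiAntiInvariants Φ) : ⁅C, A⁆ = 0 := by
  rw [Ring.lie_def, mul_comm_of_mem_rosatiSymmIdeal_of_mem_rosatiAntiInvariants hη₀ hG₀ hC hA, sub_self]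

/-- The bracket of `End⁰(X)` splits along `End⁰(X) = I ⊕ 𝔲(X)`: `⁅C + A, C' + A'⁆ = ⁅C, C'⁆ + ⁅A, A'⁆` with
`⁅C, C'⁆ ∈ I`, `⁅A, A'⁆ ∈ 𝔲(X)` — a product of Lie algebras. [cite: LooijengaLunts1997, §3, (3.6) Proposition, p. 14 L76] -/
theorem lie_add_add_eq {C C' A A' : endAlgRat Φ} (hC : C ∈ rosatiSymmIdeal Φ G₀) (hC' : C' ∈ rosatiSymmIdeal Φ G₀)
    (hA : A ∈ rosatiAntiInvariants Φ) (hA' : A' ∈ rosatiAntiInvariants Φ) :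
    ⁅C + A, C' + A'⁆ = ⁅C, C'⁆ + ⁅A, A'⁆ ∧ ⁅C, C'⁆ ∈ rosatiSymmIdeal Φ G₀ ∧ ⁅A, A'⁆ ∈ rosatiAntiInvariants Φ := by
  refine ⟨?_, lie_mem_rosatiSymmIdeal hη₀ hG₀ C hC', lie_mem_rosatiAntiInvariants A hA'⟩
  rw [add_rlie, rlie_add, rlie_add, lie_eq_zero_of_mem_rosatiSymmIdeal_of_mem_rosatiAntiInvariants hη₀ hG₀ hC hA',
    rlie_swap A C', lie_eq_zero_of_mem_rosatiSymmIdeal_of_mem_rosatiAntiInvariants hη₀ hG₀ hC' hA, neg_zero, add_zero,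
    zero_add]

end OnePolarisation

end Decomposition

/-! ## §7 Consequences: `𝔲(X)` in the commutative case and for a trivial Rosati involution -/

section Consequences

variable {Φ} {η₀ : E [⋀^Fin 2]→L[ℝ] ℝ} (hη₀ : IsRiemannForm Φ η₀) {G₀ : Matrix ι ι ℚ}
  (hG₀ : G₀.map (Rat.cast : ℚ → ℝ) = latticeGram Φ η₀)
include hη₀ hG₀

/-- **Commutative `End⁰(X)`: `𝔲(X) = End⁰(X)^-`** — all Rosati involutions coincide and `𝔲(X)` is the whole
`-1`-eigenspace (e.g. `End⁰(X) = K` a CM field with complex conjugation: the purely imaginary elements, Looijenga–Lunts'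
"`𝔲(m, F)` can be identified with the purely imaginary scalars in `K`"; `End⁰(X)` a totally real field: `𝔲(X) = 0`).
[cite: LooijengaLunts1997, §3, (3.7) Lemma, p. 15–16] -/
theorem rosatiAntiInvariants_eq_rosatiSkew_of_forall_mul_comm (hc : ∀ A B : endAlgRat Φ, A * B = B * A) :
    rosatiAntiInvariants Φ = rosatiSkew Φ G₀ := by
  refine le_antisymm (rosatiAntiInvariants_le_rosatiSkew hη₀ hG₀) fun A hA ↦ ?_
  exact (mem_rosatiAntiInvariants_iff_forall_commute hη₀ hG₀).2 ⟨hA, fun B _ ↦ hc A B⟩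

omit hη₀ hG₀ in
/-- Commutative `End⁰(X)`: `I = End⁰(X)^+`. [cite: LooijengaLunts1997, §3, (3.7)–(3.8), p. 15–16] -/
theorem rosatiSymmIdeal_eq_rosatiSymm_of_forall_mul_comm (hc : ∀ A B : endAlgRat Φ, A * B = B * A) :
    rosatiSymmIdeal Φ G₀ = rosatiSymm Φ G₀ := by
  refine le_antisymm (sup_le le_rfl (Submodule.span_le.2 ?_)) rosatiSymm_le_rosatiSymmIdeal
  rintro C ⟨A, -, B, -, rfl⟩
  rw [Ring.lie_def, hc A B, sub_self]
  exact zero_mem _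

/-- **Trivial Rosati involution (`End⁰(X)^+ = End⁰(X)`, e.g. `End⁰(X) = ℚ` or a totally real field): `𝔲(X) = 0`**
("It is trivial except in the following cases …"). [cite: LooijengaLunts1997, §3, (3.7) Lemma, p. 15] -/
theorem rosatiAntiInvariants_eq_bot_of_rosatiSymm_eq_top (h : rosatiSymm Φ G₀ = ⊤) : rosatiAntiInvariants Φ = ⊥ := by
  refine eq_bot_iff.2 fun A hA ↦ ?_
  have h1 : A ∈ rosatiSymm Φ G₀ ⊓ rosatiSkew Φ G₀ :=
    Submodule.mem_inf.2 ⟨h ▸ Submodule.mem_top, rosatiAntiInvariants_le_rosatiSkew hη₀ hG₀ hA⟩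
  rwa [rosatiSymm_inf_rosatiSkew_eq_bot] at h1

omit hη₀ hG₀ in
/-- Trivial Rosati involution: `I = End⁰(X)`. [cite: LooijengaLunts1997, §3, (3.7)–(3.8), p. 15–16] -/
theorem rosatiSymmIdeal_eq_top_of_rosatiSymm_eq_top (h : rosatiSymm Φ G₀ = ⊤) : rosatiSymmIdeal Φ G₀ = ⊤ :=
  eq_top_iff.2 (h ▸ rosatiSymm_le_rosatiSymmIdeal)

/-- `1 ∈ I` (`1 ∈ End⁰(X)^+`), so `1 ∉ 𝔲(X)` unless `End⁰(X) = 0`: the scalars lie in the `I`-summand ("this isomorphism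
makes `h` correspond to a scalar operator in `End⁰(X)`"). [cite: LooijengaLunts1997, §3, (3.6) Proposition, p. 14 L75] -/
theorem one_mem_rosatiSymmIdeal : (1 : endAlgRat Φ) ∈ rosatiSymmIdeal Φ G₀ :=
  rosatiSymm_le_rosatiSymmIdeal (one_mem_rosatiSymm hη₀ hG₀)

/-- `1 ∉ 𝔲(X)` for a non-zero abelian variety. [cite: LooijengaLunts1997, §3, (3.6) Proposition, p. 14 L75–L76] -/
theorem one_not_mem_rosatiAntiInvariants [Nonempty ι] : (1 : endAlgRat Φ) ∉ rosatiAntiInvariants Φ := by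
  intro h1
  have h : (1 : endAlgRat Φ) ∈ rosatiSymmIdeal Φ G₀ ⊓ rosatiAntiInvariants Φ :=
    Submodule.mem_inf.2 ⟨one_mem_rosatiSymmIdeal hη₀ hG₀, h1⟩
  rw [rosatiSymmIdeal_inf_rosatiAntiInvariants_eq_bot hη₀ hG₀, Submodule.mem_bot] at h
  exact one_ne_zero h

end Consequences

/-! ## §8 The same in Mathlib's `LieIdeal` language (commutator Lie algebra of `End⁰(X)`) -/

section LiePackaging

-- The commutator Lie ring of the associative `ℚ`-algebra `End⁰(X) = ↥(endAlgRat Φ)`: Mathlib's reducible NON-instance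
-- `LieRing.ofAssociativeRing`, enabled file-locally exactly as in Mathlib's `Algebra/Lie/SkewAdjoint.lean` and the
-- lane's `ComplexTorusTotalLieAlgebra.lean`; its bracket is the ring commutator `⁅A, B⁆ = AB - BA` used above.
attribute [local instance 100] LieRing.ofAssociativeRing

variable {Φ}

/-- **`𝔲(X)` as a Lie ideal of `End⁰(X)`** (Mathlib `LieIdeal`). [cite: LooijengaLunts1997, §3, p. 14 L66–L68] -/
def rosatiAntiInvariantsLieIdeal (Φ : (ι → ℝ) ≃L[ℝ] E) : LieIdeal ℚ (endAlgRat Φ) :=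
  { rosatiAntiInvariants Φ with
    lie_mem := fun {T _} hA ↦ lie_mem_rosatiAntiInvariants T hA }

/-- The carrier of the Lie ideal `𝔲(X)` is `rosatiAntiInvariants Φ`. [cite: LooijengaLunts1997, §3, p. 14 L66–L68] -/
@[simp] theorem mem_rosatiAntiInvariantsLieIdeal_iff {A : endAlgRat Φ} :
    A ∈ rosatiAntiInvariantsLieIdeal Φ ↔ A ∈ rosatiAntiInvariants Φ :=
  Iff.rfl

/-- `(𝔲(X) : LieIdeal).toSubmodule = rosatiAntiInvariants Φ`. [cite: LooijengaLunts1997, §3, p. 14 L66–L68] -/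
theorem rosatiAntiInvariantsLieIdeal_toSubmodule :
    (rosatiAntiInvariantsLieIdeal Φ).toSubmodule = rosatiAntiInvariants Φ :=
  rfl

section OnePolarisation

variable {η₀ : E [⋀^Fin 2]→L[ℝ] ℝ} (hη₀ : IsRiemannForm Φ η₀) {G₀ : Matrix ι ι ℚ}
  (hG₀ : G₀.map (Rat.cast : ℚ → ℝ) = latticeGram Φ η₀)

/-- **`I` as a Lie ideal of `End⁰(X)`** (Mathlib `LieIdeal`). [cite: LooijengaLunts1997, §3, (3.6) Proposition, p. 14 L73–L74] -/
def rosatiSymmLieIdeal : LieIdeal ℚ (endAlgRat Φ) :=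
  { rosatiSymmIdeal Φ G₀ with
    lie_mem := fun {T _} hC ↦ lie_mem_rosatiSymmIdeal hη₀ hG₀ T hC }

/-- The carrier of the Lie ideal `I` is `rosatiSymmIdeal Φ G₀`. [cite: LooijengaLunts1997, §3, (3.6), p. 14 L73–L74] -/
@[simp] theorem mem_rosatiSymmLieIdeal_iff {C : endAlgRat Φ} :
    C ∈ rosatiSymmLieIdeal hη₀ hG₀ ↔ C ∈ rosatiSymmIdeal Φ G₀ :=
  Iff.rfl

/-- `(I : LieIdeal).toSubmodule = rosatiSymmIdeal Φ G₀`. [cite: LooijengaLunts1997, §3, (3.6), p. 14 L73–L74] -/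
theorem rosatiSymmLieIdeal_toSubmodule : (rosatiSymmLieIdeal hη₀ hG₀).toSubmodule = rosatiSymmIdeal Φ G₀ :=
  rfl

/-- **`I` IS "the Lie ideal of `End⁰(X)` that is generated by `End⁰(X)^+`"**: it is Mathlib's `LieSubmodule.lieSpan` of
`End⁰(X)^+` in the adjoint module `End⁰(X)`. [cite: LooijengaLunts1997, §3, (3.6) Proposition, p. 14 L73–L74] -/
theorem rosatiSymmLieIdeal_eq_lieSpan :
    rosatiSymmLieIdeal hη₀ hG₀ = LieSubmodule.lieSpan ℚ (endAlgRat Φ) (rosatiSymm Φ G₀ : Set (endAlgRat Φ)) := by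
  refine le_antisymm ?_ (LieSubmodule.lieSpan_le.2 fun A hA ↦ rosatiSymm_le_rosatiSymmIdeal hA)
  intro C hC
  have h : rosatiSymmIdeal Φ G₀ ≤
      (LieSubmodule.lieSpan ℚ (endAlgRat Φ) (rosatiSymm Φ G₀ : Set (endAlgRat Φ))).toSubmodule :=
    rosatiSymmIdeal_le (fun A hA ↦ LieSubmodule.subset_lieSpan hA)
      (fun T C hC ↦ (LieSubmodule.lieSpan ℚ (endAlgRat Φ) (rosatiSymm Φ G₀ : Set (endAlgRat Φ))).lie_mem hC)
  exact h hC

include hη₀ hG₀ in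
/-- **(3.6), last clause, in `LieIdeal` form: `I` and `𝔲(X)` are complementary Lie ideals of `End⁰(X)` with
`⁅I, 𝔲(X)⁆ = ⊥`** — `End⁰(X) = I × 𝔲(X)` as Lie algebras.
[cite: LooijengaLunts1997, §3, (3.6) Proposition, p. 14 L76 ("Moreover, `End⁰(X) = 𝔤_NS(X; ℚ)_0 × 𝔲(X)`")] -/
theorem isCompl_rosatiSymmLieIdeal_rosatiAntiInvariantsLieIdeal :
    IsCompl (rosatiSymmLieIdeal hη₀ hG₀) (rosatiAntiInvariantsLieIdeal Φ) := by
  rw [← LieSubmodule.isCompl_toSubmodule]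
  exact isCompl_rosatiSymmIdeal_rosatiAntiInvariants hη₀ hG₀

include hη₀ hG₀ in
/-- `⁅I, 𝔲(X)⁆ = ⊥`. [cite: LooijengaLunts1997, §3, (3.6) Proposition, p. 14 L76] -/
theorem lie_rosatiSymmLieIdeal_rosatiAntiInvariantsLieIdeal_eq_bot :
    ⁅rosatiSymmLieIdeal hη₀ hG₀, rosatiAntiInvariantsLieIdeal Φ⁆ = ⊥ := by
  rw [LieSubmodule.lie_eq_bot_iff]
  intro C hC A hA
  exact lie_eq_zero_of_mem_rosatiSymmIdeal_of_mem_rosatiAntiInvariants hη₀ hG₀ hC hA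

end OnePolarisation

end LiePackaging

/-! ## §9 "Hence kills the subalgebra of `Hdg(X)` generated by this group": `𝔲(X)` kills `D•(X)`

`End(H₁(X; ℝ))` acts on `H•(X; ℂ) = ⋀• H¹(X; ℝ) ⊗ ℂ = Alt^•_ℝ(E; ℂ)` by derivations; the tree's carrier of this action is
`adAlt T` (`DerivationExtension`: `(ad T β)(v₁, …, v_k) = Σᵢ β(v₁, …, T vᵢ, …, v_k)`, the differential of the pull-back
action, transposition on `1`-forms), applied to `T = ρ_r(A) = analyticRepReal Φ Φ A_ℝ`.  Looijenga–Lunts let `End⁰(X)` act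
on `V^*` "contragradiently", i.e. by `-ad`; the two differ by a sign, which is immaterial for the VANISHING statements
below. -/

section KillsDivisorClasses

open Literature.LinearAlgebra.Alternating

variable {Φ} {η₀ : E [⋀^Fin 2]→L[ℝ] ℝ} (hη₀ : IsRiemannForm Φ η₀)

include hη₀ in
/-- **"`𝔲(X)` kills the Néron–Severi group"**, as the derivation `ad ρ_r(A)` of `⋀² H¹(X; ℝ) = Alt²_ℝ(E; ℝ)`: for `A ∈ 𝔲(X)`,
read on `E = H₁(X; ℝ)` as `ρ_r(A) = Φ ∘ A_ℝ ∘ Φ⁻¹`, and every `θ ∈ NS_ℚ(X)`,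
`(ad ρ_r(A) θ)(u, v) = θ(ρ_r(A)u, v) + θ(u, ρ_r(A)v) = 0`. [cite: LooijengaLunts1997, §3, p. 16 L85–L86] -/
theorem adAlt_analyticRepReal_eq_zero_of_mem_rosatiAntiInvariants {A : endAlgRat Φ}
    (hA : A ∈ rosatiAntiInvariants Φ) {θ : E [⋀^Fin 2]→L[ℝ] ℝ} (hθ : θ ∈ neronSeveriQ Φ) :
    adAlt (analyticRepReal Φ Φ ((A : Matrix ι ι ℚ).map (Rat.cast : ℚ → ℝ))) θ = 0 := by
  ext v
  have hv : v = ![v 0, v 1] := by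
    ext i
    fin_cases i <;> rfl
  rw [hv, adAlt_apply_two, ContinuousAlternatingMap.coe_zero, Pi.zero_apply]
  have h0 : v 0 = Φ (Φ.symm (v 0)) := (Φ.apply_symm_apply _).symm
  have h1 : v 1 = Φ (Φ.symm (v 1)) := (Φ.apply_symm_apply _).symm
  rw [h0, h1, analyticRepReal_apply, analyticRepReal_apply]
  exact apply_mulVec_add_apply_mulVec_eq_zero hη₀ hA hθ _ _

include hη₀ in
/-- The same on `H²(X; ℂ) ⊇ NS_ℚ(X)`: `ad ρ_r(A)` kills the complex-valued form `θ_ℂ` of every `θ ∈ NS_ℚ(X)`, `A ∈ 𝔲(X)`.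
[cite: LooijengaLunts1997, §3, p. 16 L85–L86] -/
theorem adAlt_analyticRepReal_ofRealForm_eq_zero_of_mem_rosatiAntiInvariants {A : endAlgRat Φ}
    (hA : A ∈ rosatiAntiInvariants Φ) {θ : E [⋀^Fin 2]→L[ℝ] ℝ} (hθ : θ ∈ neronSeveriQ Φ) :
    adAlt (analyticRepReal Φ Φ ((A : Matrix ι ι ℚ).map (Rat.cast : ℚ → ℝ))) (ofRealForm θ) = 0 := by
  rw [ofRealForm, ← compContinuousAlternatingMap_adAlt,
    adAlt_analyticRepReal_eq_zero_of_mem_rosatiAntiInvariants hη₀ hA hθ]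
  ext v
  simp

omit [Fintype ι] [DecidableEq ι] in
/-- **Leibniz**: a derivation `ad T` of `⋀• H¹ ⊗ ℂ` that kills the `2`-forms `η₀, …, η_{p-1}` kills their wedge monomial
`((1 ∧ η₀) ∧ η₁) ∧ ⋯ ∧ η_{p-1}` ("hence kills the subalgebra … generated by" them). [cite: LooijengaLunts1997, §3, p. 16 L85–L86] -/
theorem adAlt_wedgeFamily_eq_zero (T : E →L[ℝ] E) :
    ∀ (p : ℕ) (η : Fin p → E [⋀^Fin 2]→L[ℝ] ℂ), (∀ i, adAlt T (η i) = 0) → adAlt T (wedgeFamily p η) = 0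
  | 0, η, _ => adAlt_of_degree_zero T _
  | p + 1, η, hη => by
    rw [wedgeFamily_succ, adAlt_wedge, adAlt_wedgeFamily_eq_zero T p (Fin.init η) fun i ↦ hη _, hη,
      ContinuousAlternatingMap.zero_wedge, ContinuousAlternatingMap.wedge_zero, add_zero]

include hη₀ in
/-- **"Hence `𝔲(X)` kills the subalgebra of `Hdg(X)` generated by the Néron–Severi group"**: for `A ∈ 𝔲(X)` and every
`p`, the derivation `ad ρ_r(A)` of `H^{2p}(X; ℂ) = Alt^{2p}_ℝ(E; ℂ)` vanishes on `Dᵖ(X) = divisorClasses Φ p`, the `ℚ`-span of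
the wedge monomials `E₁ ∧ ⋯ ∧ E_p` of classes `Eᵢ ∈ NS(X)` (the degree-`2p` part of that subalgebra).
[cite: LooijengaLunts1997, §3, p. 16 L85–L86] -/
theorem adAlt_analyticRepReal_eq_zero_of_mem_divisorClasses {A : endAlgRat Φ}
    (hA : A ∈ rosatiAntiInvariants Φ) {p : ℕ} {c : E [⋀^Fin (2 * p)]→L[ℝ] ℂ} (hc : c ∈ divisorClasses Φ p) :
    adAlt (analyticRepReal Φ Φ ((A : Matrix ι ι ℚ).map (Rat.cast : ℚ → ℝ))) c = 0 := by
  induction hc using Submodule.span_induction with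
  | mem x hx =>
    obtain ⟨η, rfl⟩ := hx
    exact adAlt_wedgeFamily_eq_zero _ p _ fun i ↦
      adAlt_analyticRepReal_ofRealForm_eq_zero_of_mem_rosatiAntiInvariants hη₀ hA
        (neronSeveriGroup_le_neronSeveriQ Φ (η i).2)
  | zero => exact map_zero _
  | add x y _ _ hx hy => rw [map_add, hx, hy, add_zero]
  | smul q x _ hx => rw [adAlt_smul_right, hx, smul_zero]

include hη₀ in
/-- **"So as soon as `𝔲(X)` acts nontrivially on `Hdg(X)`, `X` will have Hodge classes that are not in this subalgebra"**:
a class of degree `2p` (e.g. a Hodge class) that is moved by `ad ρ_r(A)` for some `A ∈ 𝔲(X)` is not in `Dᵖ(X)`.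
[cite: LooijengaLunts1997, §3, p. 16 L87–L88] -/
theorem not_mem_divisorClasses_of_adAlt_analyticRepReal_ne_zero {A : endAlgRat Φ} (hA : A ∈ rosatiAntiInvariants Φ)
    {p : ℕ} {c : E [⋀^Fin (2 * p)]→L[ℝ] ℂ} (h : adAlt (analyticRepReal Φ Φ ((A : Matrix ι ι ℚ).map (Rat.cast : ℚ → ℝ))) c ≠ 0) :
    c ∉ divisorClasses Φ p :=
  fun hc ↦ h (adAlt_analyticRepReal_eq_zero_of_mem_divisorClasses hη₀ hA hc)

include hη₀ in
/-- **`Dᵖ(X) ⊊ H^{2p}_Hodge(X)` as soon as `𝔲(X)` moves a Hodge class of degree `2p`** ("`X` will have Hodge classes that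
are not in this subalgebra"): the tree's `divisorClasses Φ p ≤ hodgeClasses Φ p` (A4-15) is then strict.
[cite: LooijengaLunts1997, §3, p. 16 L87–L88] -/
theorem divisorClasses_lt_hodgeClasses_of_adAlt_analyticRepReal_ne_zero {A : endAlgRat Φ}
    (hA : A ∈ rosatiAntiInvariants Φ) {p : ℕ} {c : E [⋀^Fin (2 * p)]→L[ℝ] ℂ} (hc : c ∈ hodgeClasses Φ p)
    (h : adAlt (analyticRepReal Φ Φ ((A : Matrix ι ι ℚ).map (Rat.cast : ℚ → ℝ))) c ≠ 0) :
    divisorClasses Φ p < hodgeClasses Φ p :=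
  SetLike.lt_iff_le_and_exists.2
    ⟨divisorClasses_le_hodgeClasses Φ p, c, hc, not_mem_divisorClasses_of_adAlt_analyticRepReal_ne_zero hη₀ hA h⟩

end KillsDivisorClasses

end ComplexTorus

end Literature.Geometry.Kaehler
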